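import Summits.FinalStateConjecture.FinalStateConjecture.Theses.PhaseMixingCapture
import Literature.Geometry.Lorentzian.KerrDataSchwarzschildMetric
import Literature.Geometry.Lorentzian.TrivialDataAdmissible
import Mathlib.MeasureTheory.Measure.Lebesgue.EqHaar
import Literature.Geometry.Lorentzian.CauchyProblemMGHDExistence
import Literature.Geometry.Lorentzian.LeviCivitaProofs

/-!
# Disproof of `CaptureSuffices` — findings (cdisprove seat, crux `stmt-FinalStateConjecture-9953`,
# route `PhaseMixingCapture`, rank 6) — cycles 1 (gen-1 seat) and 2 (gen-2 seat)

Standing adversary's work file for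
`Summit.FinalStateConjecture.FinalStateConjecture.Theses.PhaseMixingCapture.CaptureSuffices :=
NearExtremalKappaCapture → BulkKerrCapture → WeakCosmicCensorshipMGHD → FinalStateConjecture`
(the route's whole large-data "front end" filed as ONE typed conditional). Prose lives in
docstrings; everything below is `lean check`ed, rc 0, NO `sorry`.

**Verdict after cycle 2: the crux still RESISTS refutation (§A is airtight: any kill constructs an
MGHD with complete `𝓘⁺`), and a NEW MISSTATEMENT of its capture hypotheses is documented and
machine-checked modulo print-true facts (§G, "naked members"): the data classes of items 10606 /
10696 contain, at distance `≍ M·χ` (`χ = 1 − (a/M)² ≍ κ²`) from the reference datum, exact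
Kerr–Schild data whose developments are NOT far-complete sub-extremal black holes — the
overspinning members `M' < |a|` of the mass family at fixed spin (naked ring, no horizon) and the
exposed-edge sub-extremal members `M' < (M² + a²)/(2M) = M − Mχ/2` (outer horizon strictly below
the slice edge `r = M`). Consequences: in every un-pinned data topology (`δ < -1/2`, the only
useful ones by §B/§D) the near-extremal hypothesis is FALSE for every exponent package with
`γ < 1` (`near_inner_false_of_gamma_lt_one`, `nearExtremalKappaCaptureAt_forces_one_le_gamma`) —
the "κ-power basin" shrinks at least like `κ²` for kinematic reasons, the AKU-type `κ`-uniform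
basin (`γ = 0`) is not expressible by item 10606, and `γ = 1` with `c(M) ≤ K(M)·M/2` is the
ceiling the typing allows (`basin_le_half_defect_of_one_le`); the bulk basin of item 10696 is at
most `K(M)·M(1 − a₁²)/2` (`bulk_inner_false_of_threshold_lt`, `bulk_eps_le_threshold`). For a
PROVER of the crux nothing changes logically (the packages are adversarial anyway, §B); for the
PLANNER's repair of 10606/10696 (cycle-1 advice: fix `δ < -1/2`, `k = 2`, explicit `γ, p`) it is
binding: `γ ≥ 1`, or re-type near-extremal capture as a threshold statement over data containing
a marginally outer trapped sphere enclosing the edge with conclusion in the CLOSED family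
`|a'| ≤ M'` (Kehle–Unger / AKU shape). Landed under `Theorems/CaptureSuffices/Negative/` in
cycle 2: `NakedMemberThresholds.lean` (§G1–§G2), `NakedMembers.lean` (§G3) and
`NakedMemberTightness.lean` (§G5) — ALL ACCEPTED: p77988 (`NakedMemberThresholds`, commit 13a041d08eaf),
p81640 (`NakedMembers`), p81061 (`NakedMemberTightness`); importable by ideators / planners / provers.

**Cycle 1 (gen-1 seat), kept verbatim below as §A–§F:** the crux RESISTS refutation, but it is
MISSTATED relative to the route's mechanism (§B: its capture hypotheses are worth only their
adversarial witnesses). No `¬` theorem is reachable; FOUR negative-lemma files are LANDED (all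
ACCEPTED 2026-08-16) under `Theorems/CaptureSuffices/Negative/` and may be imported by
ideators/planners/provers: `AdversarialWitnesses.lean` = §A0–§B here (p74403, commit
0274205a4597), `CounterexampleShape.lean` = §C (p74020, 961a6148152f), `KerrMassPinning.lean` = §D
for `δ ≥ 0` (p74406, d2495bafdf3e), `KerrMassPinningCritical.lean` = §D for `δ ≥ -1/2` (p75151,
97ac7e92540b). This work file stays self-contained (same theorems under this namespace) so that it
elaborates on any farm snapshot.

## A. Why no Lean refutation is reachable (structural; `not_captureSuffices_iff`, §C)
`¬ CaptureSuffices ↔ NearExtremalKappaCapture ∧ BulkKerrCapture ∧ WeakCosmicCensorshipMGHD ∧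
¬ FinalStateConjecture`: a disproof PROVES both Kerr-capture statements and weak cosmic censorship
(MGHD form, over the non-vacuous carrier `VacuumCauchyDevelopment`) and REFUTES the summit. Granted
the capture statements the crux is literally `WeakCosmicCensorshipMGHD ↔ FinalStateConjecture`
(`captureSuffices_iff_wcc_iff_fsc`; the summit implies censorship by monotonicity of
curve-genericity). Every counterexample has the shape `not_captureSuffices_witness`: an ADMISSIBLE,
CENSORED vacuum datum (MGHD exists, all MGHDs have complete `𝓘⁺`) with an MGHD admitting no
exhaustive sub-extremal `C²` Kerr decomposition — so a disproof must CONSTRUCT a maximal vacuum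
Cauchy development with complete `𝓘⁺`. Junk hunt (all negative, recorded so nobody repeats it):
* `Kerr.Facts`, `Kerr.SliceFacts` are `Prop`-classes of true chart facts WITHOUT instances in the
  tree: the capture statements (`∀ [Facts] [SliceFacts], …`) can be neither instantiated-and-refuted
  nor discharged vacuously; refuting either needs the instances PLUS a maximal development of Kerr
  data violating a conclusion that is true in print for Kerr itself (stationary, complete `𝓘⁺`).
* basins are never empty: `dataWeightedSobolevEDist_self = 0 < ofReal (c·χ^γ)` (`c > 0`, `χ > 0` on
  `|a| < M`, `chi_pos`), so no parameter choice makes a capture statement vacuously provable; its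
  `∀ 𝒟, IsMaximal → …` conclusion for Kerr's own MGHDs is unprovable and unrefutable in the tree
  (no development is proved maximal; MGHD existence is the undischarged named fact
  `choquetBruhat_geroch_exists_mghd_cauchy`).
* `WeakCosmicCensorshipMGHD`/`FinalStateConjecture` are not vacuous: `admissibleVacuumData ℝ³ ∋
  trivialData` (tree, `TrivialDataAdmissible.lean`; §E), `HasLeviCivita` is a proved `Fact`,
  `Spacetime` bundles `T2Space` (no non-Hausdorff doubling breaks `IsMaximal`), `IsCauchyHypersurface`
  is the corrected endless-curve notion (audits g4/g6 of the summit; sibling disproof files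
  `Cruxes/TameCensorship/Disproof.lean`, `Cruxes/KerrShieldedSettles/Disproof.lean`).
* `ledger negatives --problem FinalStateConjecture` / `Literature/Barriers/FinalStateConjecture/*`:
  nothing bites a conditional whose conclusion is the summit (barriers there concern extremal
  horizons, superradiance, trapping, naked-singularity instability, non-smooth `𝓘⁺`, slowly
  rotating frontier — technique barriers for ranks 2–4, not for the front end).
So the only conceivable kill is MATHEMATICAL — a censored non-settling world — and none is in print:
a stable smooth non-Kerr stationary AF vacuum exterior (excluded near Kerr by
Alexakis–Ionescu–Klainerman arXiv:0904.0982, in general only under analyticity, Chruściel–Costa–Heusler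
arXiv:1205.6112), an eternal bound cluster / time-periodic AF vacuum dynamics (excluded near `𝓘` by
Alexakis–Schlue, and for genuinely periodic solutions by Bičák–Scholtz–Tod / Gibbons–Stewart), generic
parking at extremality (third law false non-generically: Kehle–Unger arXiv:2211.15742; generic
codimension-one picture conjectured, Dafermos 2025 §6, AKU arXiv:2410.16234), infinitely many
ever-smaller holes forming at ever-later times (no result either way). None is constructible in Lean.

## B. MISSTATEMENT: the capture hypotheses are worth only their adversarial witnesses (§B below)
`NearExtremalKappaCapture = ∀ [..], ∃ (s δ k γ p a₁), …` and `BulkKerrCapture = ∀ [..], ∀ a₁ < 1,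
∃ (s δ k), …` are EXISTENTIAL in their exponent packages, and their witness sets are monotone
(`dataWeightedSobolevEDist_mono_indices`, `Real.rpow_le_rpow_of_exponent_ge` on `0 < χ ≤ 1`,
`Spacetime.ConvergesTo.of_le`). PROVED: for every threshold package `(s₀, δ₀, γ₀, p₀, a₀ < 1)`,
`NearExtremalKappaCapture ↔ (sharp form: s ≥ s₀, δ ≥ δ₀, γ ≥ γ₀, p ≥ p₀, a₁ ≥ a₀, k = 0, C ≥ 0)`,
`BulkKerrCapture ↔ (sharp form: s ≥ s₀, δ ≥ δ₀, k = 0, C ≥ 0)`, and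
`CaptureSuffices ↔ (sharp Near → sharp Bulk → WCC → FSC)` (`captureSuffices_iff_sharp`).
Reading for a PROVER of the crux (who consumes the capture items as hypotheses, hence must work for
every witness):
1. (regularity) it receives convergence to Kerr only in `C⁰` (`ConvergesToKerr … 0`), while the
   summit demands `FinalStateDecomposition … 2` (`C²` on near-zone slabs): two derivatives of
   convergence must be manufactured from nothing, i.e. the quantitative part of Kerr stability
   re-proved inside the crux;
2. (topology) it receives basins only in `H^s_δ` with `δ ≥ δ₀` for any `δ₀`; for `δ ≥ 0` (indeed
   `δ ≥ -1/2`, both proved) these basins see the `1/r` tail: §D proves that two Kerr–Schild data sets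
   of the same spin and different mass are at INFINITE distance (`dataWeightedSobolevEDist_kerr_eq_top`
   for `δ ≥ 0`, `dataWeightedSobolevEDist_kerr_eq_top_of_neg_half_le` for `δ ≥ -1/2`, any spin `a`),
   so membership in a basin pins the ADM mass of the datum to the
   reference `M` (print: Bartnik 1986 Thm 4.2), whereas the near field of a late slice of a radiating
   development is close to Kerr with the smaller Bondi mass — no Cauchy slice of a development that
   radiates a macroscopic amount of energy is ever in a basin, and the front end cannot apply the
   capture hypotheses to the given development at all;
3. (exponents) it receives the near-extremal basin `c·χ^γ` only with `γ` beyond any bound and `c`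
   unknown: "polynomial closeness to Kerr relative to `κ` suffices" (rationale (ii) of the route) is
   NOT available inside the crux — along windows parking at extremality (`χ → 0`) closeness faster
   than EVERY power of `χ` is needed, and along windows with `χ` bounded below `BulkKerrCapture`
   alone applies, so `NearExtremalKappaCapture` is idle in any proof of the crux as typed.
REPAIR (planner): fix the packages as explicit route constants shared by items 10606 / 10696 / 9953 —
`k := 2`; `(s, δ)` numerals with `δ < -1/2` in the convention of `WeightedNorms.lean` (so that
`δM/r` tails and radiation fields have finite norm; e.g. the Klainerman–Szeftel initial-data norm);
`γ, p` numerals (the card's "explicit powers") — or state 9953 over universally quantified packages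
in a declared admissible window (`∀ s ≥ s*, ∀ δ ∈ [δ₋, δ₊], ∀ γ ≤ γ*, …`). As typed, 9953 is in
print exactly as hard as `WeakCosmicCensorshipMGHD → FinalStateConjecture` with bare hands.
This is not a refutation: the misstated crux is presumably TRUE (it is implied by the summit, §E).

## C–F. Index of the checked content
§A0 `not_captureSuffices_iff`; §A1 monotonicity lemmas; §B sharp forms and the three equivalences;
§C genericity monotonicity, `captureSuffices_iff_wcc_iff_fsc`, `not_captureSuffices_witness`;
§D Kerr mass pinning, general spin (`norm_hFun_sub_hFun_ge_kerr`, `lintegral_eq_top_of_inv_sq_le`,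
`dataWeightedSobolevEDist_kerr_eq_top`, `kerr_not_mem_basin`);
§E load-bearing bookkeeping (`example`s: FSC → crux, ¬hypothesis → crux; `without_wcc_iff`;
non-vacuity `exists_censored_admissible_of_wcc`); §F the repaired crux `CaptureSufficesAt s δ k γ p`
(fixed packages; implied by the current crux: `captureSufficesAt_of_captureSuffices`).
Rev 2b: §D also covers the CRITICAL weight `δ ≥ -1/2` (`lintegral_eq_top_of_inv_cube_le`,
`dataWeightedSobolevEDist_kerr_eq_top_of_neg_half_le`; landed as `KerrMassPinningCritical.lean`): the
repair threshold `δ < -1/2` is certified on the divergent side.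


## G (cycle 2). NAKED AND EXPOSED-EDGE MEMBERS OF THE BASINS — the kinematic ceiling `γ ≥ 1` (§G below)
Both capture items quantify over ALL smooth vacuum data `D` on the truncated slice
`Kerr.slice a M = {t* = 0, r > M}` in a weighted-Sobolev ball around `Kerr.data M a M`. Among them
is the MASS FAMILY AT FIXED SPIN `M' ↦ Kerr.data M' a M` (`0 ≤ M'`; the slice depends on `a`
only; every member is smooth vacuum data on the truncated slice — the ring `{r = 0}` is cut away;
constraints = the tree's named fact `Kerr.data_isVacuumConstraintSolution`, true in print for every
real `a`). Its members with `M' < |a|` are OVERSPINNING Kerr–Schild data (naked ring singularity,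
no horizon); its members with `|a| ≤ M' < (M² + a²)/(2M)` are sub-extremal but their outer horizon
`r₊(M', a)` lies strictly BELOW the slice edge `r = M` (`rPlus_lt_iff`; the threshold is
`M − Mχ/2`, `edge_threshold_eq`; the window is non-empty, `abs_lt_edge_threshold`; the naked
segment starts at the extremal member `M' = |a|`, defect `M − |a| ∈ [Mχ/2, Mχ]`,
`defect_extremal_bounds`). For both kinds the inner edge of the data is VISIBLE from infinity: the
MGHD is the domain of dependence of the truncated slice in the Kerr–Schild spacetime `(M', a)`
(CBG + Ringström 2009 Thm 16.6), its future boundary is the outgoing null hypersurface from the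
edge 2-sphere (Hawking–Ellis Prop. 6.5.3) reaching arbitrarily large radii at bounded retarded
time `u_E`, and every INGOING null ray from a far origin leaves the development after an affine
sojourn `≈ (u_E − u_{B₀})/2` in `J⁺(B₀)`, bounded independently of the origin — exactly the
"naked-singularity MGHD (pre-singular slice) ✗" row of the sojourn-form test table in
`NullInfinity.lean` ("Why the sojourn form"; Dafermos CQG 22 (2005) §1), the clause the architects
DESIGNED to fail there. (For the reference datum and every member with `r₊(M', a) > M` the same
rays cross the horizon at `u = ∞` after sojourn `≳` their starting radius: ✓, as intended.) So no
maximal development of a visible-edge member is far-complete, and in every topology that does not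
pin the ADM mass its distance to the reference is `≍ K·|M − M'|` (`h` is affine in the mass, `k`
smooth in it, decay `r⁻¹`, `r⁻²`: finite `H^s_δ × H^{s-1}_{δ+1}` norms iff `δ < -1/2`; for
`δ ≥ -1/2` the distance is `⊤`, §D). HENCE: the distance from `Kerr.data M a M` to the nearest
honest vacuum datum none of whose developments is a far-complete sub-extremal black hole is
`Θ(M·χ) = Θ(κ²)`, for bookkeeping reasons unrelated to red-shift / superradiance / Aretakis growth.
Machine-checked (modulo the print-true hypotheses MGHD existence `hmghd` = tree fact, slice
constraints `hvac` = tree fact, visible-edge incompleteness `VisibleEdgeIncomplete`, mass-Lipschitz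
distance `MassFamilyLipschitz s δ K`): `near_inner_false_of_gamma_lt_one` (the inner clause of
10606 is false at every `M`, `a₁ < 1`, `c > 0` when `γ < 1`; witness: spin `M√(1 − χ)`, overspinning
member of mass `M(1 − χ)`, `χ` from `exists_chi_linear_lt_rpow`),
`nearExtremalKappaCaptureAt_forces_one_le_gamma` (§F's fixed-package item ⇒ `γ ≥ 1`),
`bulk_inner_false_of_threshold_lt` / `bulk_eps_le_threshold` (every `ε` witnessing the inner clause
of 10696 at `(a₁, M)` satisfies `ε ≤ K(M)·M(1 − a₁²)/2`; witness: exposed-edge sub-extremal member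
just below the threshold at spin `a₁M`). UNCONDITIONAL (no hypotheses, every `(s, δ)`):
`dataWeightedSobolevEDist_kerr_ge` (explicit lower bound `dist ≥ K'·|M − M'|` along the family,
from §D's pointwise bound on a dyadic shell) and `exists_const_basin_clears_visibleEdge` (for every
`M` some `K'(M, δ) > 0` such that for all sub-extremal `a`, `γ ≥ 1`, `c ≤ K'M/2`, no member of
defect `≥ Mχ/2` — in particular no visible-edge member — is in the basin `c·χ^γ`): the ceiling
`γ = 1` is consistent with the whole mass family. Readings: (1) the route's "basin `c·χ^γ` with EXPLICIT
`γ`" survives only with `γ ≥ 1`; "uniform in `κ`" (`γ = 0`, AKU arXiv:2603.10378 Thm 1 in symmetry)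
is unformalisable on truncated slices without changing the SHAPE of the statement (data required
to contain a marginally outer trapped sphere enclosing the edge; conclusion in the CLOSED family
`|a'| ≤ M'`; i.e. the threshold/dichotomy form of Kehle–Unger arXiv:2211.15742 / AKU
arXiv:2410.16234) — and every such certificate carried by the reference datum (trappedness of the
KS spheres `M < r < r₊`, strict stability of the MOTS) itself degenerates like a power of `κ`, so
the `O(χ)` ceiling is intrinsic to all-data statements; (2) barrier note B3 of
`BarrierNotesIdeator1g2.md` ("every datum in a basin contains strictly trapped spheres") holds for
the bulk basins (small `ε`) and for near-extremal basins only when `c·χ^γ` is below the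
trappedness margin `≍ χ` — false for `γ < 1`; (3) lines entering the near-extremal basin at
closeness `χ^γ`, `γ < 1` (the kick card's `γ < 1/2` fork) consume an instance of hypothesis 1 that
is false in print (harmless for the implication, empty as mathematics; the triage panel already
killed that fork on adversarial-`γ` grounds, §B); (4) for the planner's repair of the packages
(cycle-1 advice) `γ ≥ 1` is BINDING — with `γ < 1`, `δ < -1/2` item 10606 is refutable in print and
the route would die at rank 2 for a bookkeeping reason — and `c(M) ≤ K(M)·M/2`,
`ε(M) ≤ K(M)·M(1 − a₁²)/2`.


## HANDOFF (cycle 2, gen-2 seat)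
Landed under `Negative/` (cycle 1): AdversarialWitnesses p74403, CounterexampleShape p74020,
KerrMassPinning p74406, KerrMassPinningCritical p75151 (all ACCEPTED). Cycle 2: §G split as
`NakedMemberThresholds.lean` (§G1–§G2) + `NakedMembers.lean` (§G3) + `NakedMemberTightness.lean`
(§G5), lean check rc 0 / std axioms; ALL ACCEPTED 2026-08-16: `NakedMemberThresholds.lean` p77988
(13a041d08eaf), `NakedMembers.lean` p81640, `NakedMemberTightness.lean` p81061. Sorried: nothing. Not refutable in Lean: the crux (§A), and the capture items
themselves (refuting 10606 for `γ < 1` needs the MGHD of truncated Kerr data and its causal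
structure — print-true hypotheses `VisibleEdgeIncomplete`, `MassFamilyLipschitz` of §G, not
constructible here). Next regimes: (i) [DONE in §G5: the unconditional lower bound and the
tightness corollary]; (ii) the transplanted two-parameter family `Kerr.data M₂ a₂` restricted to
`Kerr.slice a M` (spin variations; same `Θ(χ)` ceiling expected, edge hidden iff
`M < r₊(M₂, a₂) − O(|a₂ − a|)`); (iii) when a line is PICKED / `ApproximateKerrConfiguration`-based
stubs appear: attack `NoExtremalParking`-type stubs with the Kehle–Unger mechanism and every
"enter the near-extremal basin" step with §G (closeness must be `o(χ)` including mass calibration),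
`QuietWindowApproach`-type stubs with §D (mass pinning) and the old-light obstruction.

-/

-- the problem namespace `FinalStateConjecture.FinalStateConjecture` (single-conjunct summit) trips dupNamespace
set_option linter.dupNamespace false

noncomputable section

open scoped Manifold ContDiff Topology ENNReal InnerProductSpace RealInnerProductSpace
open Set Filter MeasureTheory TopologicalSpace

namespace Summit.FinalStateConjecture.FinalStateConjecture.Cruxes.CaptureSuffices.Disproof

open Literature.Geometry.Lorentzian
open Summit.FinalStateConjecture.FinalStateConjecture.Theses.PhaseMixingCapture
  (NearExtremalKappaCapture BulkKerrCapture WeakCosmicCensorshipMGHD CaptureSuffices)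

/-! ## §0 Pure logic: the shape of a disproof -/

/-- A disproof of the crux is exactly: both capture statements, weak cosmic censorship (MGHD
form) AND a disproof of the summit statement. -/
theorem not_captureSuffices_iff :
    ¬ CaptureSuffices ↔
      NearExtremalKappaCapture ∧ BulkKerrCapture ∧ WeakCosmicCensorshipMGHD ∧
        ¬ FinalStateConjecture := by
  unfold CaptureSuffices
  tauto

/-! ## §1 Monotonicity of the weighted Sobolev distance in its indices -/

section Mono

variable {F G : Type*} [NormedAddCommGroup F] [NormedSpace ℝ F] [NormedAddCommGroup G]
  [NormedSpace ℝ G] [MeasureSpace F]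

/-- The weighted Sobolev seminorm `H^s_δ` is monotone in `(s, δ)` (larger `s`: more derivative
terms; larger `δ`: heavier weights `(1 + ‖x‖)^{2(δ+m)} ≥ (1 + ‖x‖)^{2(δ'+m)}` … since
`1 + ‖x‖ ≥ 1`). -/
theorem weightedSobolevSeminorm_mono_indices (U : Set F) {s s' : ℕ} {δ δ' : ℝ} (hs : s ≤ s')
    (hδ : δ ≤ δ') (f : F → G) :
    weightedSobolevSeminorm U s δ f ≤ weightedSobolevSeminorm U s' δ' f := by
  unfold weightedSobolevSeminorm
  refine ENNReal.rpow_le_rpow ?_ (by norm_num)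
  calc ∑ m ∈ Finset.range (s + 1),
        ∫⁻ x in U, ENNReal.ofReal ((1 + ‖x‖) ^ (2 * (δ + m) : ℝ) * ‖iteratedFDeriv ℝ m f x‖ ^ 2)
      ≤ ∑ m ∈ Finset.range (s + 1),
        ∫⁻ x in U, ENNReal.ofReal ((1 + ‖x‖) ^ (2 * (δ' + m) : ℝ) * ‖iteratedFDeriv ℝ m f x‖ ^ 2) := by
        refine Finset.sum_le_sum fun m _ ↦ lintegral_mono fun x ↦ ENNReal.ofReal_le_ofReal ?_
        refine mul_le_mul_of_nonneg_right ?_ (sq_nonneg _)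
        refine Real.rpow_le_rpow_of_exponent_le (by have := norm_nonneg x; linarith) ?_
        linarith
    _ ≤ ∑ m ∈ Finset.range (s' + 1),
        ∫⁻ x in U, ENNReal.ofReal ((1 + ‖x‖) ^ (2 * (δ' + m) : ℝ) * ‖iteratedFDeriv ℝ m f x‖ ^ 2) :=
        Finset.sum_le_sum_of_subset (Finset.range_subset_range.2 (by omega))

end Mono

/-- The data distance `H^s_δ × H^{s-1}_{δ+1}` is monotone in `(s, δ)`. -/
theorem dataWeightedSobolevEDist_mono_indices {U : TopologicalSpace.Opens E3} {s s' : ℕ}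
    {δ δ' : ℝ} (hs : s ≤ s') (hδ : δ ≤ δ') (D₁ D₂ : InitialDataSet 𝓘(ℝ, E3) U) :
    InitialDataSet.dataWeightedSobolevEDist s δ D₁ D₂ ≤
      InitialDataSet.dataWeightedSobolevEDist s' δ' D₁ D₂ := by
  unfold InitialDataSet.dataWeightedSobolevEDist
  exact add_le_add (weightedSobolevSeminorm_mono_indices _ hs hδ _)
    (weightedSobolevSeminorm_mono_indices _ (Nat.sub_le_sub_right hs 1) (by linarith) _)

/-! ## §2 The sub-extremality factor `χ = 1 − (a/M)²` lies in `(0, 1]` -/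

/-- For sub-extremal `(M, a)` with `M > 0`, `χ = 1 − (a/M)² > 0`. -/
theorem chi_pos {M a : ℝ} (hM : 0 < M) (h : Kerr.IsSubextremal M a) : 0 < 1 - (a / M) ^ 2 := by
  have h1 : |a / M| < 1 := by
    rw [abs_div, abs_of_pos hM, div_lt_one hM]
    exact h
  have h2 : (a / M) ^ 2 < 1 := by
    have := sq_lt_one_iff_abs_lt_one (a / M)
    exact this.2 h1
  linarith

/-- `χ = 1 − (a/M)² ≤ 1`. -/
theorem chi_le_one {M a : ℝ} : 1 - (a / M) ^ 2 ≤ 1 := by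
  linarith [sq_nonneg (a / M)]


/-! ## §3 The capture hypotheses in SHARP (adversarial-witness) form

`NearExtremalKappaCapture` and `BulkKerrCapture` are existential in their exponent packages
`(s, δ, k, γ, p, a₁)` resp. `(s, δ, k)`. As HYPOTHESES of `CaptureSuffices` they are therefore
worth exactly their weakest admissible witnesses. The sharp forms (right-hand sides below, no new
definitions) fix `k = 0` (only `C⁰` convergence to Kerr), add `0 ≤ C`, and push every other
exponent beyond an arbitrary threshold: Sobolev indices `s ≥ s₀`, `δ ≥ δ₀`, near-extremal basin
exponent `γ ≥ γ₀`, modulus exponent `p ≥ p₀`, spin threshold `a₁ ≥ a₀`; otherwise verbatim the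
route decls. -/

/-- **Sharpening the near-extremal capture hypothesis costs nothing.** For every threshold
package (with `a₀ < 1`), `NearExtremalKappaCapture` is EQUIVALENT to its adversarial-witness
form. -/
theorem nearExtremalKappaCapture_iff_sharp (s₀ : ℕ) (δ₀ γ₀ p₀ a₀ : ℝ) (ha₀ : a₀ < 1) :
    NearExtremalKappaCapture ↔
      ∀ [Kerr.Facts] [Kerr.SliceFacts], ∃ (s : ℕ) (δ γ p a₁ : ℝ),
        (s₀ ≤ s ∧ δ₀ ≤ δ ∧ γ₀ ≤ γ ∧ p₀ ≤ p ∧ a₀ ≤ a₁) ∧ a₁ < 1 ∧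
        ∀ (M : ℝ) (hM : 0 < M), ∃ c > (0 : ℝ), ∃ C ≥ (0 : ℝ), ∀ a : ℝ, a₁ * M ≤ |a| →
          Kerr.IsSubextremal M a →
          ∀ (D : InitialDataSet 𝓘(ℝ, E3) (Kerr.slice a M)) [D.metric.HasLeviCivita],
            D.IsVacuumConstraintSolution →
            InitialDataSet.dataWeightedSobolevEDist s δ D (Kerr.data M a M hM.le) <
              ENNReal.ofReal (c * (1 - (a / M) ^ 2) ^ γ) →
            ∀ 𝒟 : VacuumCauchyDevelopment D, 𝒟.IsMaximal →
              ∃ (M' a' : ℝ) (𝒟oc : Set 𝒟.carrier), Kerr.IsSubextremal M' a' ∧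
                (∀ [𝒟.metric.HasLeviCivita], ∃ B₀ : Set (Kerr.slice a M), IsCompact B₀ ∧
                  ∀ σ : ℝ, 0 < σ → ∃ B₁ : Set (Kerr.slice a M), IsCompact B₁ ∧
                    ∀ q ∈ {q : Kerr.slice a M | Kerr.afRadius a M + 1 ≤ ‖(q : E3)‖}, q ∉ B₁ →
                      ∀ (ray : ℝ → 𝒟.carrier) (dom : Set ℝ),
                        𝒟.metric.IsNormalisedNullRayFrom 𝒟.timeOrientation 𝒟.embed 𝒟.normal q ray
                          dom →
                        ¬ BddAbove dom ∨ ENNReal.ofReal σ ≤ sojournTime ray dom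
                          (𝒟.metric.causalFuture 𝒟.timeOrientation (𝒟.embed '' B₀))) ∧
                𝒟.toSpacetime.ConvergesToKerr 𝒟oc M' a' 0 ∧
                |M' - M| + |a' - a| ≤ C * (1 - (a / M) ^ 2) ^ (-p) *
                  √(InitialDataSet.dataWeightedSobolevEDist s δ D (Kerr.data M a M hM.le)).toReal := by
  constructor
  · intro h hF hSF
    obtain ⟨s, δ, k, γ, p, a₁, ha₁, H⟩ := @h hF hSF
    refine ⟨max s s₀, max δ δ₀, max γ γ₀, max p p₀, max a₁ a₀,
      ⟨le_max_right _ _, le_max_right _ _, le_max_right _ _, le_max_right _ _, le_max_right _ _⟩,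
      max_lt ha₁ ha₀, ?_⟩
    intro M hM
    obtain ⟨c, hc, C, HC⟩ := H M hM
    refine ⟨c, hc, max C 0, le_max_right _ _, ?_⟩
    intro a ha hsub D inst hvac hdist 𝒟 hmax
    have hχ0 : 0 < 1 - (a / M) ^ 2 := chi_pos hM hsub
    have hχ1 : 1 - (a / M) ^ 2 ≤ 1 := chi_le_one
    have ha' : a₁ * M ≤ |a| :=
      le_trans (mul_le_mul_of_nonneg_right (le_max_left _ _) hM.le) ha
    have hmono := dataWeightedSobolevEDist_mono_indices (le_max_left s s₀) (le_max_left δ δ₀)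
      D (Kerr.data M a M hM.le)
    have hdist' : InitialDataSet.dataWeightedSobolevEDist s δ D (Kerr.data M a M hM.le) <
        ENNReal.ofReal (c * (1 - (a / M) ^ 2) ^ γ) := by
      refine lt_of_le_of_lt hmono (lt_of_lt_of_le hdist (ENNReal.ofReal_le_ofReal ?_))
      exact mul_le_mul_of_nonneg_left
        (Real.rpow_le_rpow_of_exponent_ge hχ0 hχ1 (le_max_left γ γ₀)) hc.le
    obtain ⟨M', a', 𝒟oc, hsub', hfar, hconv, hmod⟩ := HC a ha' hsub D hvac hdist' 𝒟 hmax
    refine ⟨M', a', 𝒟oc, hsub', hfar, Spacetime.ConvergesTo.of_le hconv (Nat.zero_le k), ?_⟩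
    have hfin : InitialDataSet.dataWeightedSobolevEDist (max s s₀) (max δ δ₀) D
        (Kerr.data M a M hM.le) ≠ ⊤ := ne_top_of_lt hdist
    have h1 : (1 - (a / M) ^ 2) ^ (-p) ≤ (1 - (a / M) ^ 2) ^ (-max p p₀) :=
      Real.rpow_le_rpow_of_exponent_ge hχ0 hχ1 (neg_le_neg (le_max_left p p₀))
    have h2 : √(InitialDataSet.dataWeightedSobolevEDist s δ D (Kerr.data M a M hM.le)).toReal ≤
        √(InitialDataSet.dataWeightedSobolevEDist (max s s₀) (max δ δ₀) D
          (Kerr.data M a M hM.le)).toReal :=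
      Real.sqrt_le_sqrt (ENNReal.toReal_mono hfin hmono)
    have h3 : 0 ≤ (1 - (a / M) ^ 2) ^ (-p) := Real.rpow_nonneg hχ0.le _
    calc |M' - M| + |a' - a|
        ≤ C * (1 - (a / M) ^ 2) ^ (-p) *
            √(InitialDataSet.dataWeightedSobolevEDist s δ D (Kerr.data M a M hM.le)).toReal := hmod
      _ ≤ max C 0 * (1 - (a / M) ^ 2) ^ (-p) *
            √(InitialDataSet.dataWeightedSobolevEDist s δ D (Kerr.data M a M hM.le)).toReal := by
          have : 0 ≤ (1 - (a / M) ^ 2) ^ (-p) *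
              √(InitialDataSet.dataWeightedSobolevEDist s δ D (Kerr.data M a M hM.le)).toReal :=
            mul_nonneg h3 (Real.sqrt_nonneg _)
          nlinarith [le_max_left C 0]
      _ ≤ max C 0 * (1 - (a / M) ^ 2) ^ (-max p p₀) *
            √(InitialDataSet.dataWeightedSobolevEDist (max s s₀) (max δ δ₀) D
              (Kerr.data M a M hM.le)).toReal := by
          have hC : 0 ≤ max C 0 := le_max_right _ _
          exact mul_le_mul (mul_le_mul_of_nonneg_left h1 hC) h2 (Real.sqrt_nonneg _)
            (mul_nonneg hC (h3.trans h1))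
  · intro h hF hSF
    obtain ⟨s, δ, γ, p, a₁, -, ha₁, H⟩ := @h hF hSF
    refine ⟨s, δ, 0, γ, p, a₁, ha₁, ?_⟩
    intro M hM
    obtain ⟨c, hc, C, -, HC⟩ := H M hM
    exact ⟨c, hc, C, HC⟩

/-- **Sharpening the bulk capture hypothesis costs nothing.** -/
theorem bulkKerrCapture_iff_sharp (s₀ : ℕ) (δ₀ : ℝ) :
    BulkKerrCapture ↔
      ∀ [Kerr.Facts] [Kerr.SliceFacts], ∀ a₁ : ℝ, a₁ < 1 → ∃ (s : ℕ) (δ : ℝ), (s₀ ≤ s ∧ δ₀ ≤ δ) ∧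
        ∀ (M : ℝ) (hM : 0 < M), ∃ ε > (0 : ℝ), ∃ C ≥ (0 : ℝ), ∀ a : ℝ, |a| ≤ a₁ * M →
          ∀ (D : InitialDataSet 𝓘(ℝ, E3) (Kerr.slice a M)) [D.metric.HasLeviCivita],
            D.IsVacuumConstraintSolution →
            InitialDataSet.dataWeightedSobolevEDist s δ D (Kerr.data M a M hM.le) <
              ENNReal.ofReal ε →
            ∀ 𝒟 : VacuumCauchyDevelopment D, 𝒟.IsMaximal →
              ∃ (M' a' : ℝ) (𝒟oc : Set 𝒟.carrier), Kerr.IsSubextremal M' a' ∧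
                (∀ [𝒟.metric.HasLeviCivita], ∃ B₀ : Set (Kerr.slice a M), IsCompact B₀ ∧
                  ∀ σ : ℝ, 0 < σ → ∃ B₁ : Set (Kerr.slice a M), IsCompact B₁ ∧
                    ∀ q ∈ {q : Kerr.slice a M | Kerr.afRadius a M + 1 ≤ ‖(q : E3)‖}, q ∉ B₁ →
                      ∀ (ray : ℝ → 𝒟.carrier) (dom : Set ℝ),
                        𝒟.metric.IsNormalisedNullRayFrom 𝒟.timeOrientation 𝒟.embed 𝒟.normal q ray
                          dom →
                        ¬ BddAbove dom ∨ ENNReal.ofReal σ ≤ sojournTime ray dom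
                          (𝒟.metric.causalFuture 𝒟.timeOrientation (𝒟.embed '' B₀))) ∧
                𝒟.toSpacetime.ConvergesToKerr 𝒟oc M' a' 0 ∧
                |M' - M| + |a' - a| ≤
                  C * √(InitialDataSet.dataWeightedSobolevEDist s δ D (Kerr.data M a M hM.le)).toReal := by
  constructor
  · intro h hF hSF a₁ ha₁
    obtain ⟨s, δ, k, H⟩ := @h hF hSF a₁ ha₁
    refine ⟨max s s₀, max δ δ₀, ⟨le_max_right _ _, le_max_right _ _⟩, ?_⟩
    intro M hM
    obtain ⟨ε, hε, C, HC⟩ := H M hM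
    refine ⟨ε, hε, max C 0, le_max_right _ _, ?_⟩
    intro a ha D inst hvac hdist 𝒟 hmax
    have hmono := dataWeightedSobolevEDist_mono_indices (le_max_left s s₀) (le_max_left δ δ₀)
      D (Kerr.data M a M hM.le)
    have hdist' : InitialDataSet.dataWeightedSobolevEDist s δ D (Kerr.data M a M hM.le) <
        ENNReal.ofReal ε := lt_of_le_of_lt hmono hdist
    obtain ⟨M', a', 𝒟oc, hsub', hfar, hconv, hmod⟩ := HC a ha D hvac hdist' 𝒟 hmax
    refine ⟨M', a', 𝒟oc, hsub', hfar, Spacetime.ConvergesTo.of_le hconv (Nat.zero_le k), ?_⟩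
    have hfin : InitialDataSet.dataWeightedSobolevEDist (max s s₀) (max δ δ₀) D
        (Kerr.data M a M hM.le) ≠ ⊤ := ne_top_of_lt hdist
    have h2 : √(InitialDataSet.dataWeightedSobolevEDist s δ D (Kerr.data M a M hM.le)).toReal ≤
        √(InitialDataSet.dataWeightedSobolevEDist (max s s₀) (max δ δ₀) D
          (Kerr.data M a M hM.le)).toReal :=
      Real.sqrt_le_sqrt (ENNReal.toReal_mono hfin hmono)
    calc |M' - M| + |a' - a|
        ≤ C * √(InitialDataSet.dataWeightedSobolevEDist s δ D (Kerr.data M a M hM.le)).toReal :=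
          hmod
      _ ≤ max C 0 * √(InitialDataSet.dataWeightedSobolevEDist s δ D (Kerr.data M a M hM.le)).toReal := by
          nlinarith [le_max_left C 0, Real.sqrt_nonneg
            (InitialDataSet.dataWeightedSobolevEDist s δ D (Kerr.data M a M hM.le)).toReal]
      _ ≤ max C 0 * √(InitialDataSet.dataWeightedSobolevEDist (max s s₀) (max δ δ₀) D
            (Kerr.data M a M hM.le)).toReal :=
          mul_le_mul_of_nonneg_left h2 (le_max_right _ _)
  · intro h hF hSF a₁ ha₁
    obtain ⟨s, δ, -, H⟩ := @h hF hSF a₁ ha₁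
    refine ⟨s, δ, 0, ?_⟩
    intro M hM
    obtain ⟨ε, hε, C, -, HC⟩ := H M hM
    exact ⟨ε, hε, C, HC⟩

/-- **The crux with adversarial capture hypotheses is the same crux.** For every threshold
package, `CaptureSuffices` is equivalent to the implication whose capture hypotheses give
only `C⁰` convergence to Kerr, in Sobolev topologies `H^s_δ` with `s ≥ s₀`, `δ ≥ δ₀`, with
near-extremal basin exponent `γ ≥ γ₀`, modulus exponent `p ≥ p₀` and spin threshold
`a₁ ≥ a₀`. -/
theorem captureSuffices_iff_sharp (s₀ : ℕ) (δ₀ γ₀ p₀ a₀ : ℝ) (ha₀ : a₀ < 1) :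
    CaptureSuffices ↔
      ((∀ [Kerr.Facts] [Kerr.SliceFacts], ∃ (s : ℕ) (δ γ p a₁ : ℝ),
          (s₀ ≤ s ∧ δ₀ ≤ δ ∧ γ₀ ≤ γ ∧ p₀ ≤ p ∧ a₀ ≤ a₁) ∧ a₁ < 1 ∧
          ∀ (M : ℝ) (hM : 0 < M), ∃ c > (0 : ℝ), ∃ C ≥ (0 : ℝ), ∀ a : ℝ, a₁ * M ≤ |a| →
            Kerr.IsSubextremal M a →
            ∀ (D : InitialDataSet 𝓘(ℝ, E3) (Kerr.slice a M)) [D.metric.HasLeviCivita],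
              D.IsVacuumConstraintSolution →
              InitialDataSet.dataWeightedSobolevEDist s δ D (Kerr.data M a M hM.le) <
                ENNReal.ofReal (c * (1 - (a / M) ^ 2) ^ γ) →
              ∀ 𝒟 : VacuumCauchyDevelopment D, 𝒟.IsMaximal →
                ∃ (M' a' : ℝ) (𝒟oc : Set 𝒟.carrier), Kerr.IsSubextremal M' a' ∧
                  (∀ [𝒟.metric.HasLeviCivita], ∃ B₀ : Set (Kerr.slice a M), IsCompact B₀ ∧
                    ∀ σ : ℝ, 0 < σ → ∃ B₁ : Set (Kerr.slice a M), IsCompact B₁ ∧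
                      ∀ q ∈ {q : Kerr.slice a M | Kerr.afRadius a M + 1 ≤ ‖(q : E3)‖}, q ∉ B₁ →
                        ∀ (ray : ℝ → 𝒟.carrier) (dom : Set ℝ),
                          𝒟.metric.IsNormalisedNullRayFrom 𝒟.timeOrientation 𝒟.embed 𝒟.normal q ray
                            dom →
                          ¬ BddAbove dom ∨ ENNReal.ofReal σ ≤ sojournTime ray dom
                            (𝒟.metric.causalFuture 𝒟.timeOrientation (𝒟.embed '' B₀))) ∧
                  𝒟.toSpacetime.ConvergesToKerr 𝒟oc M' a' 0 ∧
                  |M' - M| + |a' - a| ≤ C * (1 - (a / M) ^ 2) ^ (-p) *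
                    √(InitialDataSet.dataWeightedSobolevEDist s δ D (Kerr.data M a M hM.le)).toReal) →
      (∀ [Kerr.Facts] [Kerr.SliceFacts], ∀ a₁ : ℝ, a₁ < 1 → ∃ (s : ℕ) (δ : ℝ), (s₀ ≤ s ∧ δ₀ ≤ δ) ∧
          ∀ (M : ℝ) (hM : 0 < M), ∃ ε > (0 : ℝ), ∃ C ≥ (0 : ℝ), ∀ a : ℝ, |a| ≤ a₁ * M →
            ∀ (D : InitialDataSet 𝓘(ℝ, E3) (Kerr.slice a M)) [D.metric.HasLeviCivita],
              D.IsVacuumConstraintSolution →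
              InitialDataSet.dataWeightedSobolevEDist s δ D (Kerr.data M a M hM.le) <
                ENNReal.ofReal ε →
              ∀ 𝒟 : VacuumCauchyDevelopment D, 𝒟.IsMaximal →
                ∃ (M' a' : ℝ) (𝒟oc : Set 𝒟.carrier), Kerr.IsSubextremal M' a' ∧
                  (∀ [𝒟.metric.HasLeviCivita], ∃ B₀ : Set (Kerr.slice a M), IsCompact B₀ ∧
                    ∀ σ : ℝ, 0 < σ → ∃ B₁ : Set (Kerr.slice a M), IsCompact B₁ ∧
                      ∀ q ∈ {q : Kerr.slice a M | Kerr.afRadius a M + 1 ≤ ‖(q : E3)‖}, q ∉ B₁ →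
                        ∀ (ray : ℝ → 𝒟.carrier) (dom : Set ℝ),
                          𝒟.metric.IsNormalisedNullRayFrom 𝒟.timeOrientation 𝒟.embed 𝒟.normal q ray
                            dom →
                          ¬ BddAbove dom ∨ ENNReal.ofReal σ ≤ sojournTime ray dom
                            (𝒟.metric.causalFuture 𝒟.timeOrientation (𝒟.embed '' B₀))) ∧
                  𝒟.toSpacetime.ConvergesToKerr 𝒟oc M' a' 0 ∧
                  |M' - M| + |a' - a| ≤
                    C * √(InitialDataSet.dataWeightedSobolevEDist s δ D (Kerr.data M a M hM.le)).toReal) →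
        WeakCosmicCensorshipMGHD → FinalStateConjecture) := by
  unfold CaptureSuffices
  rw [nearExtremalKappaCapture_iff_sharp s₀ δ₀ γ₀ p₀ a₀ ha₀, bulkKerrCapture_iff_sharp s₀ δ₀]



/-! ## §4 What a disproof must exhibit: the shape of every counterexample -/

section Genericity

variable {E : Type*} [NormedAddCommGroup E] [NormedSpace ℝ E] {H : Type*} [TopologicalSpace H]
  {I : ModelWithCorners ℝ E H} {X : Type*} [TopologicalSpace X] [ChartedSpace H X]
  [IsManifold I ((⊤ : ℕ∞) : WithTop ℕ∞) X]

/-- Christodoulou's curve-genericity is monotone in the property (on the admissible class). -/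
theorem isChristodoulouGeneric_mono {𝓓 : Set (InitialDataSet I X)}
    {P Q : InitialDataSet I X → Prop} (hPQ : ∀ d ∈ 𝓓, P d → Q d) {m : ℕ}
    (h : InitialDataSet.IsChristodoulouGeneric 𝓓 P m) :
    InitialDataSet.IsChristodoulouGeneric 𝓓 Q m := by
  intro d hd
  obtain ⟨F, hF, h0, hinj, hadm, hexc⟩ := h d ⟨hd.1, fun hP ↦ hd.2 (hPQ d hd.1 hP)⟩
  exact ⟨F, hF, h0, hinj, hadm, fun c hc hmem ↦ hexc c hc ⟨hmem.1, fun hP ↦ hmem.2 (hPQ _ hmem.1 hP)⟩⟩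

end Genericity

/-- **The crux is `WCC ↔ FSC` over the capture statements.** Since the summit statement implies
weak cosmic censorship (MGHD form) by monotonicity of genericity, `CaptureSuffices` says exactly
that, granted the two capture statements, weak cosmic censorship and the final state conjecture
are EQUIVALENT. -/
theorem captureSuffices_iff_wcc_iff_fsc :
    CaptureSuffices ↔ (NearExtremalKappaCapture → BulkKerrCapture →
      (WeakCosmicCensorshipMGHD ↔ FinalStateConjecture)) := by
  have hmono : FinalStateConjecture → WeakCosmicCensorshipMGHD := by
    intro h X _ _ _ _ _ _
    exact isChristodoulouGeneric_mono (fun D _ hP ↦ ⟨hP.1, fun 𝒟 h𝒟 ↦ (hP.2 𝒟 h𝒟).1⟩) (h X)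
  unfold CaptureSuffices
  constructor
  · intro h hN hB
    exact ⟨h hN hB, hmono⟩
  · intro h hN hB hW
    exact (h hN hB).1 hW

/-- Bookkeeping: from "an MGHD exists, all MGHDs are complete, but not all MGHDs are complete
AND decomposed" extract an MGHD that is not decomposed. -/
private theorem exists_max_not_dec {α : Type*} {Max Comp Dec : α → Prop} (hex : ∃ x, Max x)
    (hcomp : ∀ x, Max x → Comp x) (hnot : ¬ ((∃ x, Max x) ∧ ∀ x, Max x → Comp x ∧ Dec x)) :
    ∃ x, Max x ∧ ¬ Dec x := by
  by_contra hno
  push Not at hno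
  exact hnot ⟨hex, fun x hx ↦ ⟨hcomp x hx, hno x hx⟩⟩

/-- **Shape of every counterexample to the crux.** A disproof of `CaptureSuffices` exhibits a
`3`-manifold `Σ` and an ADMISSIBLE vacuum datum `D` on it which is CENSORED (it has a maximal
vacuum Cauchy development, and every one of its MGHDs has complete future null infinity in the
sojourn sense) and yet has an MGHD whose future admits NO exhaustive `C²` decomposition into
finitely many sub-extremal boosted Kerr near zones plus a flat radiation zone. (If the
exceptional datum of `¬ FinalStateConjecture` is not itself censored, the admissible curve through
it supplied by `WeakCosmicCensorshipMGHD` carries a censored exceptional datum.) In particular a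
disproof must CONSTRUCT a maximal vacuum Cauchy development with complete `𝓘⁺` — no such object
exists in the tree (MGHD existence is the undischarged named fact
`choquetBruhat_geroch_exists_mghd_cauchy`; no development in the tree is proved maximal). -/
theorem not_captureSuffices_witness (h : ¬ CaptureSuffices) :
    ∃ (X : Type) (_ : TopologicalSpace X) (_ : ChartedSpace E3 X)
      (_ : IsManifold (𝓡 3) ((⊤ : ℕ∞) : WithTop ℕ∞) X) (_ : T2Space X)
      (_ : SecondCountableTopology X) (_ : ConnectedSpace X) (D : InitialDataSet (𝓡 3) X),
      D ∈ admissibleVacuumData X ∧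
      ((∃ 𝒟 : VacuumCauchyDevelopment D, 𝒟.IsMaximal) ∧
        ∀ 𝒟 : VacuumCauchyDevelopment D, 𝒟.IsMaximal →
          _root_.Summit.FinalStateConjecture.HasCompleteNullInfinity 𝒟.toCauchyDevelopment) ∧
      ∃ 𝒟 : VacuumCauchyDevelopment D, 𝒟.IsMaximal ∧
        ¬ ∃ (O : Set 𝒟.carrier) (d : FinalStateDecomposition 𝒟.toSpacetime O 2),
          (∀ i, Kerr.IsSubextremal (d.mass i) (d.spin i)) ∧
            O = _root_.Summit.FinalStateConjecture.exteriorOf 𝒟.toCauchyDevelopment d.charted ∧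
              _root_.Summit.FinalStateConjecture.HasExhaustiveCharts d := by
  obtain ⟨-, -, hW, hF⟩ := not_captureSuffices_iff.1 h
  by_contra hcon
  apply hF
  intro X _ _ _ _ _ _ D hD
  by_cases hPw : (∃ 𝒟 : VacuumCauchyDevelopment D, 𝒟.IsMaximal) ∧
      ∀ 𝒟 : VacuumCauchyDevelopment D, 𝒟.IsMaximal →
        _root_.Summit.FinalStateConjecture.HasCompleteNullInfinity 𝒟.toCauchyDevelopment
  · exact absurd ⟨X, ‹_›, ‹_›, ‹_›, ‹_›, ‹_›, ‹_›, D, hD.1, hPw,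
      exists_max_not_dec hPw.1 hPw.2 hD.2⟩ hcon
  · obtain ⟨F, hFs, hF0, hFi, hFadm, hFgood⟩ := hW X D ⟨hD.1, hPw⟩
    refine ⟨F, hFs, hF0, hFi, hFadm, fun c hc hmem ↦ ?_⟩
    have hPw' : (∃ 𝒟 : VacuumCauchyDevelopment (F c), 𝒟.IsMaximal) ∧
        ∀ 𝒟 : VacuumCauchyDevelopment (F c), 𝒟.IsMaximal →
          _root_.Summit.FinalStateConjecture.HasCompleteNullInfinity 𝒟.toCauchyDevelopment := by
      by_contra hn
      exact hFgood c hc ⟨hFadm c, hn⟩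
    exact hcon ⟨X, ‹_›, ‹_›, ‹_›, ‹_›, ‹_›, ‹_›, F c, hFadm c, hPw',
      exists_max_not_dec hPw'.1 hPw'.2 hmem.2⟩


/-! ## §D Kerr mass pinning in the `δ ≥ 0` basins (general spin) -/

/-- Divergence: on a set containing `{‖y‖ > R}` in `ℝ³`, a nonnegative function bounded below
by `κ / ‖y‖²` (`κ > 0`) has infinite Lebesgue integral (dyadic annuli each contribute
`≥ 7κ 2ⁿ R · |B₁| / 4`). -/
theorem lintegral_eq_top_of_inv_sq_le {κ R : ℝ} (hκ : 0 < κ) (hR : 0 < R) {U : Set E3}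
    (hU : {y : E3 | R < ‖y‖} ⊆ U) {f : E3 → ℝ≥0∞}
    (hf : ∀ y : E3, R < ‖y‖ → ENNReal.ofReal (κ / ‖y‖ ^ 2) ≤ f y) :
    ∫⁻ y in U, f y = ⊤ := by
  set b : ℝ≥0∞ := volume (Metric.ball (0 : E3) 1) with hb
  have hb0 : b ≠ 0 :=
    (Metric.isOpen_ball.measure_pos volume ⟨0, Metric.mem_ball_self one_pos⟩).ne'
  have hbtop : b ≠ ⊤ := measure_ball_lt_top.ne
  have key : ∀ n : ℕ, ENNReal.ofReal (κ * R) * b * n ≤ ∫⁻ y in U, f y := by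
    intro n
    set ρ : ℝ := 2 ^ n * R with hρ
    have h2n : (1 : ℝ) ≤ 2 ^ n := one_le_pow₀ (by norm_num)
    have hρR : R ≤ ρ := le_mul_of_one_le_left hR.le h2n
    have hρ0 : 0 < ρ := lt_of_lt_of_le hR hρR
    set A : Set E3 := Metric.closedBall 0 (2 * ρ) \ Metric.closedBall 0 ρ with hA
    have hAU : A ⊆ U := by
      intro y hy
      apply hU
      have hy2 : ρ < ‖y‖ := lt_of_not_ge fun h ↦ hy.2 (mem_closedBall_zero_iff.2 h)
      exact lt_of_le_of_lt hρR hy2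
    have hAm : MeasurableSet A := measurableSet_closedBall.diff measurableSet_closedBall
    have hfA : ∀ y ∈ A, ENNReal.ofReal (κ / (2 * ρ) ^ 2) ≤ f y := by
      intro y hy
      have hy1 : ‖y‖ ≤ 2 * ρ := mem_closedBall_zero_iff.1 hy.1
      have hy2 : ρ < ‖y‖ := lt_of_not_ge fun h ↦ hy.2 (mem_closedBall_zero_iff.2 h)
      refine le_trans (ENNReal.ofReal_le_ofReal ?_) (hf y (lt_of_le_of_lt hρR hy2))
      exact div_le_div_of_nonneg_left hκ.le (pow_pos (hρ0.trans hy2) 2)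
        (pow_le_pow_left₀ (norm_nonneg _) hy1 2)
    have hvol : ENNReal.ofReal (7 * ρ ^ 3) * b ≤ volume A := by
      have h1 : volume (Metric.closedBall (0 : E3) (2 * ρ)) = ENNReal.ofReal ((2 * ρ) ^ 3) * b := by
        rw [Measure.addHaar_closedBall volume (0 : E3) (by positivity : (0 : ℝ) ≤ 2 * ρ),
          finrank_euclideanSpace_fin]
      have h2 : volume (Metric.closedBall (0 : E3) ρ) = ENNReal.ofReal (ρ ^ 3) * b := by
        rw [Measure.addHaar_closedBall volume (0 : E3) hρ0.le, finrank_euclideanSpace_fin]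
      calc ENNReal.ofReal (7 * ρ ^ 3) * b
          = ENNReal.ofReal ((2 * ρ) ^ 3 - ρ ^ 3) * b := by congr 1; ring_nf
        _ = (ENNReal.ofReal ((2 * ρ) ^ 3) - ENNReal.ofReal (ρ ^ 3)) * b := by
            rw [ENNReal.ofReal_sub _ (by positivity)]
        _ = ENNReal.ofReal ((2 * ρ) ^ 3) * b - ENNReal.ofReal (ρ ^ 3) * b := by
            rw [ENNReal.sub_mul fun _ _ ↦ hbtop]
        _ = volume (Metric.closedBall (0 : E3) (2 * ρ)) - volume (Metric.closedBall (0 : E3) ρ) := by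
            rw [h1, h2]
        _ ≤ volume A := le_measure_sdiff
    have hn : (n : ℝ) ≤ 2 ^ n := by exact_mod_cast (Nat.lt_pow_self (by norm_num : 1 < 2)).le
    have harith : ENNReal.ofReal (κ * R) * b * n ≤
        ENNReal.ofReal (κ / (2 * ρ) ^ 2) * (ENNReal.ofReal (7 * ρ ^ 3) * b) := by
      have e1 : ENNReal.ofReal (κ * R * n) * b = ENNReal.ofReal (κ * R) * b * n := by
        rw [ENNReal.ofReal_mul (p := κ * R) (by positivity), ENNReal.ofReal_natCast]; ring
      have e2 : ENNReal.ofReal (κ / (2 * ρ) ^ 2 * (7 * ρ ^ 3)) * b =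
          ENNReal.ofReal (κ / (2 * ρ) ^ 2) * (ENNReal.ofReal (7 * ρ ^ 3) * b) := by
        rw [ENNReal.ofReal_mul (p := κ / (2 * ρ) ^ 2) (by positivity)]; ring
      rw [← e1, ← e2]
      refine mul_le_mul' (ENNReal.ofReal_le_ofReal ?_) le_rfl
      have : κ / (2 * ρ) ^ 2 * (7 * ρ ^ 3) = 7 / 4 * κ * ρ := by
        field_simp; ring
      rw [this, hρ]
      have hκR : 0 ≤ κ * R := by positivity
      nlinarith
    calc ENNReal.ofReal (κ * R) * b * n
        ≤ ENNReal.ofReal (κ / (2 * ρ) ^ 2) * (ENNReal.ofReal (7 * ρ ^ 3) * b) := harith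
      _ ≤ ENNReal.ofReal (κ / (2 * ρ) ^ 2) * volume A := mul_le_mul' le_rfl hvol
      _ = ∫⁻ _ in A, ENNReal.ofReal (κ / (2 * ρ) ^ 2) := (setLIntegral_const A _).symm
      _ ≤ ∫⁻ y in A, f y := setLIntegral_mono' hAm hfA
      _ ≤ ∫⁻ y in U, f y := lintegral_mono_set hAU
  have hc : ENNReal.ofReal (κ * R) * b ≠ 0 := by
    refine mul_ne_zero ?_ hb0
    rw [ne_eq, ENNReal.ofReal_eq_zero, not_le]
    positivity
  have : ENNReal.ofReal (κ * R) * b * ⊤ ≤ ∫⁻ y in U, f y := by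
    rw [← ENNReal.iSup_natCast, ENNReal.mul_iSup]
    exact iSup_le key
  rwa [ENNReal.mul_top hc, top_le_iff] at this


/-! ### Kerr–Schild algebra at a point `x` with `r = radius a x > 0` -/

/-- The spatial part `ℓ⃗ = (ℓ₁, ℓ₂, ℓ₃)` of the Kerr–Schild null (co)vector has Euclidean norm
`1`: `ℓ(ℓ♯) = −ℓ₀² + |ℓ⃗|² = 0` with `ℓ₀ = 1`. Stated as: `ℓ` evaluated on the tangent vector
`(0, ℓ⃗)` of the slice is `1`. -/
theorem nullCovector_ofTimeSpace_spatial_nullVector {a : ℝ} {x : E4} (hx : 0 < Kerr.radius a x) :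
    Kerr.nullCovector a x (E4.ofTimeSpace 0 (E4.spatial (Kerr.nullVector a x))) = 1 := by
  have h0 := Kerr.nullCovector_nullVector hx
  rw [Kerr.nullCovector, E4.covector_apply, Fin.sum_univ_four] at h0 ⊢
  have e0 : Kerr.nullCovectorFun a x 0 = 1 := rfl
  have c0 : (E4.ofTimeSpace 0 (E4.spatial (Kerr.nullVector a x))) 0 = 0 := rfl
  have c1 : (E4.ofTimeSpace 0 (E4.spatial (Kerr.nullVector a x))) 1 = Kerr.nullVector a x 1 := rfl
  have c2 : (E4.ofTimeSpace 0 (E4.spatial (Kerr.nullVector a x))) 2 = Kerr.nullVector a x 2 := rfl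
  have c3 : (E4.ofTimeSpace 0 (E4.spatial (Kerr.nullVector a x))) 3 = Kerr.nullVector a x 3 := rfl
  have n0 : Kerr.nullVector a x 0 = - Kerr.nullCovectorFun a x 0 := rfl
  have n1 : Kerr.nullVector a x 1 = Kerr.nullCovectorFun a x 1 := rfl
  have n2 : Kerr.nullVector a x 2 = Kerr.nullCovectorFun a x 2 := rfl
  have n3 : Kerr.nullVector a x 3 = Kerr.nullCovectorFun a x 3 := rfl
  rw [c0, c1, c2, c3, n1, n2, n3]
  rw [n0, n1, n2, n3, e0] at h0
  rw [e0]
  linarith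

/-- `|ℓ⃗|² = 1` as a statement about the Euclidean norm of `E3`. -/
theorem norm_spatial_nullVector_sq {a : ℝ} {x : E4} (hx : 0 < Kerr.radius a x) :
    ‖E4.spatial (Kerr.nullVector a x)‖ ^ 2 = 1 := by
  have h1 := nullCovector_ofTimeSpace_spatial_nullVector hx
  rw [Kerr.nullCovector, E4.covector_apply, Fin.sum_univ_four] at h1
  have c0 : (E4.ofTimeSpace 0 (E4.spatial (Kerr.nullVector a x))) 0 = 0 := rfl
  have c1 : (E4.ofTimeSpace 0 (E4.spatial (Kerr.nullVector a x))) 1 = Kerr.nullVector a x 1 := rfl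
  have c2 : (E4.ofTimeSpace 0 (E4.spatial (Kerr.nullVector a x))) 2 = Kerr.nullVector a x 2 := rfl
  have c3 : (E4.ofTimeSpace 0 (E4.spatial (Kerr.nullVector a x))) 3 = Kerr.nullVector a x 3 := rfl
  have n1 : Kerr.nullVector a x 1 = Kerr.nullCovectorFun a x 1 := rfl
  have n2 : Kerr.nullVector a x 2 = Kerr.nullCovectorFun a x 2 := rfl
  have n3 : Kerr.nullVector a x 3 = Kerr.nullCovectorFun a x 3 := rfl
  rw [c0, c1, c2, c3, n1, n2, n3] at h1
  rw [PiLp.norm_sq_eq_of_L2, Fin.sum_univ_three]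
  simp only [Real.norm_eq_abs, sq_abs, E4.spatial_apply]
  have s1 : Kerr.nullVector a x (Fin.succ 0) = Kerr.nullCovectorFun a x 1 := rfl
  have s2 : Kerr.nullVector a x (Fin.succ 1) = Kerr.nullCovectorFun a x 2 := rfl
  have s3 : Kerr.nullVector a x (Fin.succ 2) = Kerr.nullCovectorFun a x 3 := rfl
  rw [s1, s2, s3]
  nlinarith

/-- Kerr–Schild radius relations at `x = (0, y)`: `z² ≤ r²`, `r² ≤ ‖y‖²`, `‖y‖² − a² ≤ r²`. -/
theorem radius_relations (a : ℝ) (y : E3) (hr : 0 < Kerr.radius a (E4.ofTimeSpace 0 y)) :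
    (y 2) ^ 2 ≤ Kerr.radius a (E4.ofTimeSpace 0 y) ^ 2 ∧
      Kerr.radius a (E4.ofTimeSpace 0 y) ^ 2 ≤ ‖y‖ ^ 2 ∧
      ‖y‖ ^ 2 - a ^ 2 ≤ Kerr.radius a (E4.ofTimeSpace 0 y) ^ 2 := by
  set x := E4.ofTimeSpace 0 y with hxdef
  set r := Kerr.radius a x with hrdef
  have hq := Kerr.radius_quartic a x
  have hsq := Kerr.radius_sq a x
  have habs := Kerr.abs_le_sqrt_radius_discr a x
  rw [← hrdef] at hq hsq
  have hn : E4.spatialNorm x = ‖y‖ := E4.spatialNorm_ofTimeSpace 0 y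
  rw [hn] at hq hsq habs
  have hx3 : x 3 = y 2 := rfl
  rw [hx3] at hq habs hsq
  have hy : ‖y‖ ^ 2 = y 0 ^ 2 + y 1 ^ 2 + y 2 ^ 2 := by
    rw [PiLp.norm_sq_eq_of_L2, Fin.sum_univ_three]
    simp only [Real.norm_eq_abs, sq_abs]
  have hr2 : 0 < r ^ 2 := by positivity
  -- (r² − z²)(r² + a²) = r² (y₀² + y₁²) ≥ 0
  have key : (r ^ 2 - y 2 ^ 2) * (r ^ 2 + a ^ 2) = r ^ 2 * (y 0 ^ 2 + y 1 ^ 2) := by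
    have : r ^ 4 = (‖y‖ ^ 2 - a ^ 2) * r ^ 2 + a ^ 2 * y 2 ^ 2 := by linarith
    nlinarith
  have h1 : y 2 ^ 2 ≤ r ^ 2 := by
    by_contra hcon
    push Not at hcon
    have : (r ^ 2 - y 2 ^ 2) * (r ^ 2 + a ^ 2) < 0 :=
      mul_neg_of_neg_of_pos (by linarith) (by positivity)
    nlinarith [sq_nonneg (y 0), sq_nonneg (y 1)]
  refine ⟨h1, ?_, ?_⟩
  · have : r ^ 4 ≤ (‖y‖ ^ 2 - a ^ 2) * r ^ 2 + a ^ 2 * r ^ 2 := by nlinarith [sq_nonneg a]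
    have h4 : r ^ 4 = r ^ 2 * r ^ 2 := by ring
    nlinarith
  · nlinarith [le_abs_self (‖y‖ ^ 2 - a ^ 2)]

/-- The lower bound `r³/(r⁴ + a² z²) ≥ 1/(2‖y‖)` at `x = (0, y)` for `‖y‖ ≥ 2|a|`, `r > 0`
(`z² ≤ r²` and `3a² ≤ r²` give `r⁴ + a²z² ≤ (4/3) r⁴`, and `r ≤ ‖y‖`). -/
theorem scalarH_coeff_ge (a : ℝ) (y : E3) (hr : 0 < Kerr.radius a (E4.ofTimeSpace 0 y))
    (hya : 2 * |a| ≤ ‖y‖) :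
    1 / (2 * ‖y‖) ≤ Kerr.radius a (E4.ofTimeSpace 0 y) ^ 3 /
      (Kerr.radius a (E4.ofTimeSpace 0 y) ^ 4 + a ^ 2 * (E4.ofTimeSpace 0 y 3) ^ 2) := by
  obtain ⟨h1, h2, h3⟩ := radius_relations a y hr
  set r := Kerr.radius a (E4.ofTimeSpace 0 y) with hrdef
  have hx3 : E4.ofTimeSpace 0 y 3 = y 2 := rfl
  rw [hx3]
  have ha2 : 4 * a ^ 2 ≤ ‖y‖ ^ 2 := by
    have : (2 * |a|) ^ 2 ≤ ‖y‖ ^ 2 := pow_le_pow_left₀ (by positivity) hya 2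
    nlinarith [sq_abs a]
  have hra : 3 * a ^ 2 ≤ r ^ 2 := by linarith
  have hy0 : 0 < ‖y‖ := by nlinarith [norm_nonneg y]
  have hrle : r ≤ ‖y‖ := by nlinarith [norm_nonneg y]
  have e1 : a ^ 2 * y 2 ^ 2 ≤ a ^ 2 * r ^ 2 := mul_le_mul_of_nonneg_left h1 (sq_nonneg a)
  have e2 : 3 * (a ^ 2 * r ^ 2) ≤ r ^ 2 * r ^ 2 := by nlinarith [sq_nonneg r]
  have e3 : r ^ 4 ≤ r ^ 3 * ‖y‖ := by
    have : r ^ 4 = r ^ 3 * r := by ring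
    rw [this]
    exact mul_le_mul_of_nonneg_left hrle (by positivity)
  rw [div_le_div_iff₀ (by positivity) (by positivity)]
  nlinarith

/-- The metric of the Kerr data on tangent vectors of the slice (general spin):
`h_y(v, w) = g_{M,a}((0, v), (0, w))` at `(0, y)`. -/
theorem data_h_inner_apply [Kerr.Facts] [Kerr.SliceFacts] (M a r₀ : ℝ) (hM : 0 ≤ M)
    (y : Kerr.slice a r₀) (v w : E3) :
    (Kerr.data M a r₀ hM).h.inner y v w =
      Kerr.bilin M a (E4.ofTimeSpace 0 y) (E4.ofTimeSpace 0 v) (E4.ofTimeSpace 0 w) := by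
  rw [Kerr.data_h_inner, PseudoRiemannianMetric.inducedBilin_apply, Kerr.smoothMetric_val,
    Kerr.mfderiv_sliceEmbed_apply, Kerr.mfderiv_sliceEmbed_apply, Kerr.coe_sliceEmbed]
  rfl

/-- Pointwise (general spin): the metric components of two Kerr–Schild data sets with the same
spin `a` and different masses differ at `y`, `‖y‖ ≥ 2|a|`, by at least `|M − M'| / ‖y‖` in
operator norm (test on `v = w = ℓ⃗(0, y)`: `(h_M − h_{M'})(ℓ⃗, ℓ⃗) = 2(M − M') r³/(r⁴ + a²z²)`,
`ℓ⃗` being independent of `M` and of unit length). -/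
theorem norm_hFun_sub_hFun_ge_kerr [Kerr.Facts] [Kerr.SliceFacts] {M M' : ℝ} (hM : 0 ≤ M)
    (hM' : 0 ≤ M') {a r₀ : ℝ} {y : E3} (hy : y ∈ Kerr.slice a r₀) (hya : 2 * |a| ≤ ‖y‖) :
    |M - M'| / ‖y‖ ≤ ‖(Kerr.data M a r₀ hM).hFun y - (Kerr.data M' a r₀ hM').hFun y‖ := by
  set x := E4.ofTimeSpace 0 y with hxdef
  have hr : 0 < Kerr.radius a x := lt_of_le_of_lt (le_max_right _ _) (Kerr.mem_slice.1 hy)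
  obtain ⟨-, h2, -⟩ := radius_relations a y hr
  have hy0 : 0 < ‖y‖ := by nlinarith [norm_nonneg y]
  set v : E3 := E4.spatial (Kerr.nullVector a x) with hvdef
  have hv1 : ‖v‖ = 1 := by
    have h := norm_spatial_nullVector_sq hr
    rw [← hvdef] at h
    nlinarith [norm_nonneg v]
  have hℓ : Kerr.nullCovector a x (E4.ofTimeSpace 0 v) = 1 :=
    nullCovector_ofTimeSpace_spatial_nullVector hr
  set B := (Kerr.data M a r₀ hM).hFun y - (Kerr.data M' a r₀ hM').hFun y with hBdef
  set q : ℝ := Kerr.radius a x ^ 3 / (Kerr.radius a x ^ 4 + a ^ 2 * (x 3) ^ 2) with hqdef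
  have e1 : (Kerr.data M a r₀ hM).hFun y v v =
      Minkowski.bilin (E4.ofTimeSpace 0 v) (E4.ofTimeSpace 0 v) + 2 * Kerr.scalarH M a x := by
    rw [InitialDataSet.hFun_of_mem _ hy]
    have := data_h_inner_apply M a r₀ hM ⟨y, hy⟩ v v
    rw [Kerr.bilin_apply] at this
    rw [← hxdef, hℓ, mul_one, mul_one] at this
    exact this
  have e2 : (Kerr.data M' a r₀ hM').hFun y v v =
      Minkowski.bilin (E4.ofTimeSpace 0 v) (E4.ofTimeSpace 0 v) + 2 * Kerr.scalarH M' a x := by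
    rw [InitialDataSet.hFun_of_mem _ hy]
    have := data_h_inner_apply M' a r₀ hM' ⟨y, hy⟩ v v
    rw [Kerr.bilin_apply] at this
    rw [← hxdef, hℓ, mul_one, mul_one] at this
    exact this
  have hH : Kerr.scalarH M a x - Kerr.scalarH M' a x = (M - M') * q := by
    rw [hqdef, Kerr.scalarH, Kerr.scalarH]
    ring
  have hB : B v v = 2 * (M - M') * q := by
    have : B v v = (Kerr.data M a r₀ hM).hFun y v v - (Kerr.data M' a r₀ hM').hFun y v v := by
      rw [hBdef]; rfl
    rw [this, e1, e2]
    linear_combination 2 * hH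
  have h := ContinuousLinearMap.le_opNorm₂ B v v
  rw [Real.norm_eq_abs, hB, hv1, mul_one, mul_one] at h
  have hq : 1 / (2 * ‖y‖) ≤ q := scalarH_coeff_ge a y hr hya
  have hq0 : 0 ≤ q := le_trans (by positivity) hq
  have habs : |2 * (M - M') * q| = 2 * |M - M'| * q := by
    rw [abs_mul, abs_mul, abs_of_nonneg hq0, abs_of_pos (by norm_num : (0 : ℝ) < 2)]
  rw [habs] at h
  calc |M - M'| / ‖y‖ = 2 * |M - M'| * (1 / (2 * ‖y‖)) := by field_simp
    _ ≤ 2 * |M - M'| * q := mul_le_mul_of_nonneg_left hq (by positivity)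
    _ ≤ ‖B‖ := h

/-- **Mass pinning, general spin.** For `δ ≥ 0`, every `s`, every spin `a` and truncation `r₀`,
two Kerr–Schild data sets `Kerr.data M a r₀`, `Kerr.data M' a r₀` with `M ≠ M'` are at INFINITE
`H^s_δ × H^{s-1}_{δ+1}` distance (so the near-extremal basins of `NearExtremalKappaCapture`, read at
`δ ≥ 0` WLOG, pin the mass exactly as the bulk ones do). -/
theorem dataWeightedSobolevEDist_kerr_eq_top [Kerr.Facts] [Kerr.SliceFacts] {M M' : ℝ}
    (hM : 0 ≤ M) (hM' : 0 ≤ M') (hne : M ≠ M') (a r₀ : ℝ) (s : ℕ) {δ : ℝ} (hδ : 0 ≤ δ) :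
    InitialDataSet.dataWeightedSobolevEDist s δ (Kerr.data M a r₀ hM) (Kerr.data M' a r₀ hM') = ⊤ := by
  set g := (Kerr.data M a r₀ hM).hFun - (Kerr.data M' a r₀ hM').hFun with hg
  have hMM : 0 < (M - M') ^ 2 := by
    have : M - M' ≠ 0 := sub_ne_zero.2 hne
    positivity
  have hR : 0 < Kerr.afRadius a r₀ + 2 * |a| := by
    have := Kerr.afRadius_pos a r₀; positivity
  have hdiv : ∫⁻ x in (Kerr.slice a r₀ : Set E3), ENNReal.ofReal
      ((1 + ‖x‖) ^ (2 * (δ + ((0 : ℕ) : ℝ)) : ℝ) * ‖iteratedFDeriv ℝ 0 g x‖ ^ 2) = ⊤ := by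
    refine lintegral_eq_top_of_inv_sq_le hMM hR (fun y hy ↦ Kerr.mem_slice_of_lt_norm ?_)
      fun y hy ↦ ?_
    · have : 0 ≤ 2 * |a| := by positivity
      exact lt_of_le_of_lt (by linarith) hy
    have hya : 2 * |a| ≤ ‖y‖ := by linarith [(Kerr.afRadius_pos a r₀).le]
    have hyU : y ∈ Kerr.slice a r₀ :=
      Kerr.mem_slice_of_lt_norm (lt_of_le_of_lt (by linarith [abs_nonneg a]) hy)
    have hy0 : 0 < ‖y‖ := hR.trans hy
    rw [norm_iteratedFDeriv_zero]
    refine ENNReal.ofReal_le_ofReal ?_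
    have h1 : 1 ≤ (1 + ‖y‖) ^ (2 * (δ + ((0 : ℕ) : ℝ)) : ℝ) :=
      Real.one_le_rpow (by linarith [norm_nonneg y]) (by push_cast; linarith)
    have h2 : |M - M'| / ‖y‖ ≤ ‖g y‖ := by
      rw [hg, Pi.sub_apply]
      exact norm_hFun_sub_hFun_ge_kerr hM hM' hyU hya
    have h3 : (M - M') ^ 2 / ‖y‖ ^ 2 = (|M - M'| / ‖y‖) ^ 2 := by
      rw [div_pow, sq_abs]
    rw [h3]
    calc (|M - M'| / ‖y‖) ^ 2 ≤ ‖g y‖ ^ 2 := pow_le_pow_left₀ (by positivity) h2 2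
      _ = 1 * ‖g y‖ ^ 2 := (one_mul _).symm
      _ ≤ (1 + ‖y‖) ^ (2 * (δ + ((0 : ℕ) : ℝ)) : ℝ) * ‖g y‖ ^ 2 :=
          mul_le_mul_of_nonneg_right h1 (sq_nonneg _)
  have hsemi : weightedSobolevSeminorm (Kerr.slice a r₀ : Set E3) s δ g = ⊤ := by
    unfold weightedSobolevSeminorm
    have hsum : ∑ m ∈ Finset.range (s + 1), ∫⁻ x in (Kerr.slice a r₀ : Set E3), ENNReal.ofReal
        ((1 + ‖x‖) ^ (2 * (δ + m) : ℝ) * ‖iteratedFDeriv ℝ m g x‖ ^ 2) = ⊤ := by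
      refine eq_top_iff.2 (le_trans (le_of_eq hdiv.symm) ?_)
      exact Finset.single_le_sum (f := fun m : ℕ ↦ ∫⁻ x in (Kerr.slice a r₀ : Set E3), ENNReal.ofReal
        ((1 + ‖x‖) ^ (2 * (δ + m) : ℝ) * ‖iteratedFDeriv ℝ m g x‖ ^ 2)) (fun _ _ ↦ zero_le)
        (Finset.mem_range.2 (Nat.succ_pos s))
    rw [hsum]
    exact ENNReal.top_rpow_of_pos (by norm_num)
  unfold InitialDataSet.dataWeightedSobolevEDist
  rw [← hg, hsemi, top_add]


/-- **No basin around Kerr data contains Kerr data of another mass** (same spin, `δ ≥ 0`): the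
shape in which the capture items use the distance (`dist D (Kerr.data M a r₀ _) < ofReal ε`). -/
theorem kerr_not_mem_basin [Kerr.Facts] [Kerr.SliceFacts] {M M' : ℝ} (hM : 0 ≤ M) (hM' : 0 ≤ M')
    (hne : M' ≠ M) (a r₀ : ℝ) (s : ℕ) {δ : ℝ} (hδ : 0 ≤ δ) (ε : ℝ) :
    ¬ InitialDataSet.dataWeightedSobolevEDist s δ (Kerr.data M' a r₀ hM') (Kerr.data M a r₀ hM) <
      ENNReal.ofReal ε := by
  rw [dataWeightedSobolevEDist_kerr_eq_top hM' hM hne a r₀ s hδ]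
  exact not_lt_of_ge le_top


/-! ### The critical weight: `δ ≥ -1/2` -/

/-- Divergence at the critical weight: on a set containing `{‖y‖ > R}` in `ℝ³` (`R > 0`), a
function bounded below by `κ / ‖y‖³` (`κ > 0`) has infinite Lebesgue integral — every dyadic
annulus `{2ⁿR < ‖y‖ ≤ 2ⁿ⁺¹R}` contributes at least `7κ|B₁|/8`. -/
theorem lintegral_eq_top_of_inv_cube_le {κ R : ℝ} (hκ : 0 < κ) (hR : 0 < R) {U : Set E3}
    (hU : {y : E3 | R < ‖y‖} ⊆ U) {f : E3 → ℝ≥0∞}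
    (hf : ∀ y : E3, R < ‖y‖ → ENNReal.ofReal (κ / ‖y‖ ^ 3) ≤ f y) :
    ∫⁻ y in U, f y = ⊤ := by
  set b : ℝ≥0∞ := volume (Metric.ball (0 : E3) 1) with hb
  have hb0 : b ≠ 0 :=
    (Metric.isOpen_ball.measure_pos volume ⟨0, Metric.mem_ball_self one_pos⟩).ne'
  have hbtop : b ≠ ⊤ := measure_ball_lt_top.ne
  -- dyadic annuli and their partial unions
  set A : ℕ → Set E3 := fun n ↦
    Metric.closedBall 0 (2 ^ (n + 1) * R) \ Metric.closedBall 0 (2 ^ n * R) with hA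
  set S : ℕ → Set E3 := fun n ↦ Metric.closedBall 0 (2 ^ n * R) \ Metric.closedBall 0 R with hS
  have hpow : ∀ n : ℕ, (1 : ℝ) ≤ 2 ^ n := fun n ↦ one_le_pow₀ (by norm_num)
  have hAm : ∀ n, MeasurableSet (A n) := fun n ↦
    measurableSet_closedBall.diff measurableSet_closedBall
  have hSU : ∀ n, S n ⊆ U := by
    intro n y hy
    exact hU (lt_of_not_ge fun h ↦ hy.2 (mem_closedBall_zero_iff.2 h))
  have hSA : ∀ n, S n ∪ A n ⊆ S (n + 1) := by
    intro n y hy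
    rcases hy with hy | hy
    · refine ⟨mem_closedBall_zero_iff.2 ?_, hy.2⟩
      have h1 : ‖y‖ ≤ 2 ^ n * R := mem_closedBall_zero_iff.1 hy.1
      have h2 : (2 : ℝ) ^ n * R ≤ 2 ^ (n + 1) * R := by
        rw [pow_succ]; nlinarith [hpow n]
      exact h1.trans h2
    · refine ⟨hy.1, fun h ↦ hy.2 (mem_closedBall_zero_iff.2 ?_)⟩
      have h1 : ‖y‖ ≤ R := mem_closedBall_zero_iff.1 h
      nlinarith [hpow n]
  have hdisj : ∀ n, Disjoint (S n) (A n) := by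
    intro n
    rw [Set.disjoint_left]
    intro y hyS hyA
    exact hyA.2 hyS.1
  -- each annulus contributes at least `c`
  set c : ℝ≥0∞ := ENNReal.ofReal (7 * κ / 8) * b with hc
  have hAc : ∀ n, c ≤ ∫⁻ y in A n, f y := by
    intro n
    set ρ : ℝ := 2 ^ n * R with hρ
    have hρR : R ≤ ρ := le_mul_of_one_le_left hR.le (hpow n)
    have hρ0 : 0 < ρ := lt_of_lt_of_le hR hρR
    have hA' : A n = Metric.closedBall 0 (2 * ρ) \ Metric.closedBall 0 ρ := by
      simp only [hA, hρ, pow_succ]; ring_nf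
    have hfA : ∀ y ∈ A n, ENNReal.ofReal (κ / (2 * ρ) ^ 3) ≤ f y := by
      intro y hy
      rw [hA'] at hy
      have hy1 : ‖y‖ ≤ 2 * ρ := mem_closedBall_zero_iff.1 hy.1
      have hy2 : ρ < ‖y‖ := lt_of_not_ge fun h ↦ hy.2 (mem_closedBall_zero_iff.2 h)
      refine le_trans (ENNReal.ofReal_le_ofReal ?_) (hf y (lt_of_le_of_lt hρR hy2))
      exact div_le_div_of_nonneg_left hκ.le (pow_pos (hρ0.trans hy2) 3)
        (pow_le_pow_left₀ (norm_nonneg _) hy1 3)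
    have hvol : ENNReal.ofReal (7 * ρ ^ 3) * b ≤ volume (A n) := by
      have h1 : volume (Metric.closedBall (0 : E3) (2 * ρ)) = ENNReal.ofReal ((2 * ρ) ^ 3) * b := by
        rw [Measure.addHaar_closedBall volume (0 : E3) (by positivity : (0 : ℝ) ≤ 2 * ρ),
          finrank_euclideanSpace_fin]
      have h2 : volume (Metric.closedBall (0 : E3) ρ) = ENNReal.ofReal (ρ ^ 3) * b := by
        rw [Measure.addHaar_closedBall volume (0 : E3) hρ0.le, finrank_euclideanSpace_fin]
      calc ENNReal.ofReal (7 * ρ ^ 3) * b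
          = ENNReal.ofReal ((2 * ρ) ^ 3 - ρ ^ 3) * b := by congr 1; ring_nf
        _ = (ENNReal.ofReal ((2 * ρ) ^ 3) - ENNReal.ofReal (ρ ^ 3)) * b := by
            rw [ENNReal.ofReal_sub _ (by positivity)]
        _ = ENNReal.ofReal ((2 * ρ) ^ 3) * b - ENNReal.ofReal (ρ ^ 3) * b := by
            rw [ENNReal.sub_mul fun _ _ ↦ hbtop]
        _ = volume (Metric.closedBall (0 : E3) (2 * ρ)) - volume (Metric.closedBall (0 : E3) ρ) := by
            rw [h1, h2]
        _ ≤ volume (A n) := by rw [hA']; exact le_measure_sdiff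
    have harith : c = ENNReal.ofReal (κ / (2 * ρ) ^ 3) * (ENNReal.ofReal (7 * ρ ^ 3) * b) := by
      rw [hc, ← mul_assoc, ← ENNReal.ofReal_mul (by positivity)]
      congr 2
      field_simp
      ring
    calc c = ENNReal.ofReal (κ / (2 * ρ) ^ 3) * (ENNReal.ofReal (7 * ρ ^ 3) * b) := harith
      _ ≤ ENNReal.ofReal (κ / (2 * ρ) ^ 3) * volume (A n) := mul_le_mul' le_rfl hvol
      _ = ∫⁻ _ in A n, ENNReal.ofReal (κ / (2 * ρ) ^ 3) := (setLIntegral_const (A n) _).symm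
      _ ≤ ∫⁻ y in A n, f y := setLIntegral_mono' (hAm n) hfA
  -- partial sums by induction
  have key : ∀ N : ℕ, c * N ≤ ∫⁻ y in S N, f y := by
    intro N
    induction N with
    | zero => simp
    | succ N ih =>
      calc c * ((N + 1 : ℕ) : ℝ≥0∞) = c * N + c := by push_cast; ring
        _ ≤ (∫⁻ y in S N, f y) + ∫⁻ y in A N, f y := add_le_add ih (hAc N)
        _ = ∫⁻ y in S N ∪ A N, f y := (lintegral_union (hAm N) (hdisj N)).symm
        _ ≤ ∫⁻ y in S (N + 1), f y := lintegral_mono_set (hSA N)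
  have hc0 : c ≠ 0 := by
    refine mul_ne_zero ?_ hb0
    rw [ne_eq, ENNReal.ofReal_eq_zero, not_le]
    positivity
  have : c * ⊤ ≤ ∫⁻ y in U, f y := by
    rw [← ENNReal.iSup_natCast, ENNReal.mul_iSup]
    exact iSup_le fun N ↦ (key N).trans (lintegral_mono_set (hSU N))
  rwa [ENNReal.mul_top hc0, top_le_iff] at this

/-- **Mass pinning at the critical weight, general spin.** For `δ ≥ -1/2` (the threshold at which
`(1 + ‖y‖)^{2δ} · (ΔM/‖y‖)²` stops being integrable at infinity in `ℝ³`), every `s`, spin `a` and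
truncation `r₀`, two Kerr–Schild data sets of the same spin and different masses are at INFINITE
`H^s_δ × H^{s-1}_{δ+1}` distance. Supersedes `dataWeightedSobolevEDist_kerr_eq_top` (`δ ≥ 0`). -/
theorem dataWeightedSobolevEDist_kerr_eq_top_of_neg_half_le [Kerr.Facts] [Kerr.SliceFacts]
    {M M' : ℝ} (hM : 0 ≤ M) (hM' : 0 ≤ M') (hne : M ≠ M') (a r₀ : ℝ) (s : ℕ) {δ : ℝ}
    (hδ : -1 / 2 ≤ δ) :
    InitialDataSet.dataWeightedSobolevEDist s δ (Kerr.data M a r₀ hM) (Kerr.data M' a r₀ hM') = ⊤ := by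
  set g := (Kerr.data M a r₀ hM).hFun - (Kerr.data M' a r₀ hM').hFun with hg
  have hMM : 0 < (M - M') ^ 2 / 2 := by
    have : M - M' ≠ 0 := sub_ne_zero.2 hne
    positivity
  have hR : 0 < Kerr.afRadius a r₀ + 2 * |a| + 1 := by
    have := Kerr.afRadius_pos a r₀; positivity
  have hdiv : ∫⁻ x in (Kerr.slice a r₀ : Set E3), ENNReal.ofReal
      ((1 + ‖x‖) ^ (2 * (δ + ((0 : ℕ) : ℝ)) : ℝ) * ‖iteratedFDeriv ℝ 0 g x‖ ^ 2) = ⊤ := by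
    refine lintegral_eq_top_of_inv_cube_le hMM hR (fun y hy ↦ Kerr.mem_slice_of_lt_norm ?_)
      fun y hy ↦ ?_
    · have : 0 ≤ 2 * |a| := by positivity
      exact lt_of_le_of_lt (by linarith) hy
    have hpos := Kerr.afRadius_pos a r₀
    have hya : 2 * |a| ≤ ‖y‖ := by linarith [hpos.le]
    have hyU : y ∈ Kerr.slice a r₀ :=
      Kerr.mem_slice_of_lt_norm (lt_of_le_of_lt (by linarith [abs_nonneg a]) hy)
    have hy1 : 1 ≤ ‖y‖ := by linarith [abs_nonneg a, hpos.le]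
    have hy0 : 0 < ‖y‖ := by linarith
    rw [norm_iteratedFDeriv_zero]
    refine ENNReal.ofReal_le_ofReal ?_
    have h1 : (1 + ‖y‖)⁻¹ ≤ (1 + ‖y‖) ^ (2 * (δ + ((0 : ℕ) : ℝ)) : ℝ) := by
      rw [← Real.rpow_neg_one]
      exact Real.rpow_le_rpow_of_exponent_le (by linarith) (by push_cast; linarith)
    have h1' : 1 / (2 * ‖y‖) ≤ (1 + ‖y‖)⁻¹ := by
      rw [one_div, inv_le_inv₀ (by positivity) (by positivity)]
      linarith
    have hw : 1 / (2 * ‖y‖) ≤ (1 + ‖y‖) ^ (2 * (δ + ((0 : ℕ) : ℝ)) : ℝ) := h1'.trans h1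
    have h2 : |M - M'| / ‖y‖ ≤ ‖g y‖ := by
      rw [hg, Pi.sub_apply]
      exact norm_hFun_sub_hFun_ge_kerr hM hM' hyU hya
    have hg2 : (M - M') ^ 2 / ‖y‖ ^ 2 ≤ ‖g y‖ ^ 2 := by
      rw [show (M - M') ^ 2 / ‖y‖ ^ 2 = (|M - M'| / ‖y‖) ^ 2 by rw [div_pow, sq_abs]]
      exact pow_le_pow_left₀ (by positivity) h2 2
    calc (M - M') ^ 2 / 2 / ‖y‖ ^ 3 = 1 / (2 * ‖y‖) * ((M - M') ^ 2 / ‖y‖ ^ 2) := by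
          field_simp
      _ ≤ (1 + ‖y‖) ^ (2 * (δ + ((0 : ℕ) : ℝ)) : ℝ) * ‖g y‖ ^ 2 :=
          mul_le_mul hw hg2 (by positivity) (le_trans (by positivity) hw)
  have hsemi : weightedSobolevSeminorm (Kerr.slice a r₀ : Set E3) s δ g = ⊤ := by
    unfold weightedSobolevSeminorm
    have hsum : ∑ m ∈ Finset.range (s + 1), ∫⁻ x in (Kerr.slice a r₀ : Set E3), ENNReal.ofReal
        ((1 + ‖x‖) ^ (2 * (δ + m) : ℝ) * ‖iteratedFDeriv ℝ m g x‖ ^ 2) = ⊤ := by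
      refine eq_top_iff.2 (le_trans (le_of_eq hdiv.symm) ?_)
      exact Finset.single_le_sum (f := fun m : ℕ ↦ ∫⁻ x in (Kerr.slice a r₀ : Set E3), ENNReal.ofReal
        ((1 + ‖x‖) ^ (2 * (δ + m) : ℝ) * ‖iteratedFDeriv ℝ m g x‖ ^ 2)) (fun _ _ ↦ zero_le)
        (Finset.mem_range.2 (Nat.succ_pos s))
    rw [hsum]
    exact ENNReal.top_rpow_of_pos (by norm_num)
  unfold InitialDataSet.dataWeightedSobolevEDist
  rw [← hg, hsemi, top_add]


/-! ## §E Load-bearing bookkeeping and non-vacuity -/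

/-- The crux is implied by the summit statement (so it is presumably TRUE, and refutable only
through `¬ FinalStateConjecture`); stated as an `example` (a named proof of a route item from the
summit would only confuse the audit). -/
example (h : FinalStateConjecture) : CaptureSuffices := fun _ _ _ ↦ h

/-- The crux holds vacuously in any world where one of its hypotheses FAILS (route kill criteria:
then the route is dead at rank 2/4/5, not here). -/
example (h : ¬ NearExtremalKappaCapture) : CaptureSuffices := fun hN ↦ (h @hN).elim

example (h : ¬ BulkKerrCapture) : CaptureSuffices := fun _ hB ↦ (h @hB).elim

example (h : ¬ WeakCosmicCensorshipMGHD) : CaptureSuffices := fun _ _ hW ↦ (h @hW).elim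

/-- **Dropping the censorship hypothesis** adds exactly the burden of deriving censorship from
capture: `(Near → Bulk → FSC) ↔ CaptureSuffices ∧ (Near → Bulk → WCC)`. Neither side is refutable
in the tree (§A). -/
theorem without_wcc_iff :
    (NearExtremalKappaCapture → BulkKerrCapture → FinalStateConjecture) ↔
      CaptureSuffices ∧ (NearExtremalKappaCapture → BulkKerrCapture → WeakCosmicCensorshipMGHD) := by
  have h := captureSuffices_iff_wcc_iff_fsc
  unfold CaptureSuffices at h ⊢
  constructor
  · intro hF
    exact ⟨fun hN hB _ ↦ hF hN hB, fun hN hB ↦ ((h.1 fun hN hB _ ↦ hF hN hB) hN hB).2 (hF hN hB)⟩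
  · rintro ⟨hS, hW⟩ hN hB
    exact hS hN hB (hW hN hB)

section NonVacuity

variable {E : Type*} [NormedAddCommGroup E] [NormedSpace ℝ E] {H : Type*} [TopologicalSpace H]
  {I : ModelWithCorners ℝ E H} {X : Type*} [TopologicalSpace X] [ChartedSpace H X]
  [IsManifold I ((⊤ : ℕ∞) : WithTop ℕ∞) X]

/-- A curve-generic property (codimension `1`) on a nonempty admissible class holds for SOME
admissible datum (either the given datum or a member of the generic curve through it). -/
theorem exists_of_isChristodoulouGeneric_one {𝓓 : Set (InitialDataSet I X)}
    {P : InitialDataSet I X → Prop} (h : InitialDataSet.IsChristodoulouGeneric 𝓓 P 1)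
    (hne : 𝓓.Nonempty) : ∃ d ∈ 𝓓, P d := by
  obtain ⟨d, hd⟩ := hne
  by_cases hP : P d
  · exact ⟨d, hd, hP⟩
  obtain ⟨F, -, -, -, hadm, hexc⟩ := h d ⟨hd, hP⟩
  have hc : (EuclideanSpace.single 0 1 : EuclideanSpace ℝ (Fin 1)) ≠ 0 := fun h0 ↦ by
    simpa using congrArg (fun c : EuclideanSpace ℝ (Fin 1) ↦ c 0) h0
  refine ⟨F (EuclideanSpace.single 0 1), hadm _, ?_⟩
  by_contra hn
  exact hexc _ hc ⟨hadm _, hn⟩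

end NonVacuity

/-- **Non-vacuity / existential content of the censorship hypothesis.** The admissible class of
`Σ = ℝ³` contains the Minkowski data (tree: `trivialData_mem_admissibleVacuumData`), so
`WeakCosmicCensorshipMGHD` is not vacuously true and yields an admissible datum on `ℝ³` with a
MAXIMAL vacuum Cauchy development all of whose MGHDs have complete `𝓘⁺` — an object nobody can
presently construct in the tree. The same existential content sits in `¬ CaptureSuffices` (§A). -/
theorem exists_censored_admissible_of_wcc (h : WeakCosmicCensorshipMGHD) :
    ∃ D ∈ admissibleVacuumData Minkowski.slice,
      (∃ 𝒟 : VacuumCauchyDevelopment D, 𝒟.IsMaximal) ∧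
        ∀ 𝒟 : VacuumCauchyDevelopment D, 𝒟.IsMaximal →
          _root_.Summit.FinalStateConjecture.HasCompleteNullInfinity 𝒟.toCauchyDevelopment :=
  exists_of_isChristodoulouGeneric_one (h Minkowski.slice) admissibleVacuumData_slice_nonempty


/-! ## §F The repair, as Lean signatures (advisory; the planner owns statements)

The minimal repair keeping the route's shape: FIX the exponent package `(s, δ, k, γ, p)` once for the
three items, i.e. replace the existential packages of items 10606 / 10696 by route-level constants and
state 9953 at the same constants. Below, `NearExtremalKappaCaptureAt` / `BulkKerrCaptureAt` are the
route bodies with `∃ (s δ k γ p …)` resp. `∃ (s δ k)` removed (the spin threshold `a₁`, the basin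
constants `c`, `ε` and the modulus constant `C` stay existential — harmless: `BulkKerrCapture` is
universal in `a₁`, and a basin/modulus constant per `M` is inherent), and `CaptureSufficesAt` is the
repaired crux. `captureSufficesAt_of_captureSuffices`: the repaired crux is IMPLIED by the current one
(it has stronger hypotheses), so nothing proved about 9953 is lost; the repaired capture items are
STRONGER than the current ones (they imply them: `near_of_nearAt`, `bulk_of_bulkAt`). Suggested
constants (planner's call): `k = 2` (the summit's `FinalStateDecomposition … 2`); `δ < -1/2` in the
convention of `WeightedNorms.lean` so that `δM/r` tails and radiation fields on asymptotically flat
slices have finite `H^0_δ` norm (§D shows `δ ≥ 0` is useless; `δ ≥ -1/2` already pins the ADM mass),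
e.g. the Klainerman–Szeftel / Christodoulou–Klainerman decay window; `s` the regularity those proofs
consume; `γ, p` the card's explicit powers. -/

/-- `NearExtremalKappaCapture` at a FIXED exponent package `(s, δ, k, γ, p)` (route body verbatim
otherwise). -/
def NearExtremalKappaCaptureAt (s : ℕ) (δ : ℝ) (k : ℕ) (γ p : ℝ) : Prop :=
  ∀ [Kerr.Facts] [Kerr.SliceFacts], ∃ a₁ : ℝ, a₁ < 1 ∧
    ∀ (M : ℝ) (hM : 0 < M), ∃ c > (0 : ℝ), ∃ C : ℝ, ∀ a : ℝ, a₁ * M ≤ |a| →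
      Kerr.IsSubextremal M a →
      ∀ (D : InitialDataSet 𝓘(ℝ, E3) (Kerr.slice a M)) [D.metric.HasLeviCivita],
        D.IsVacuumConstraintSolution →
        InitialDataSet.dataWeightedSobolevEDist s δ D (Kerr.data M a M hM.le) <
          ENNReal.ofReal (c * (1 - (a / M) ^ 2) ^ γ) →
        ∀ 𝒟 : VacuumCauchyDevelopment D, 𝒟.IsMaximal →
          ∃ (M' a' : ℝ) (𝒟oc : Set 𝒟.carrier), Kerr.IsSubextremal M' a' ∧
            (∀ [𝒟.metric.HasLeviCivita], ∃ B₀ : Set (Kerr.slice a M), IsCompact B₀ ∧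
              ∀ σ : ℝ, 0 < σ → ∃ B₁ : Set (Kerr.slice a M), IsCompact B₁ ∧
                ∀ q ∈ {q : Kerr.slice a M | Kerr.afRadius a M + 1 ≤ ‖(q : E3)‖}, q ∉ B₁ →
                  ∀ (ray : ℝ → 𝒟.carrier) (dom : Set ℝ),
                    𝒟.metric.IsNormalisedNullRayFrom 𝒟.timeOrientation 𝒟.embed 𝒟.normal q ray
                      dom →
                    ¬ BddAbove dom ∨ ENNReal.ofReal σ ≤ sojournTime ray dom
                      (𝒟.metric.causalFuture 𝒟.timeOrientation (𝒟.embed '' B₀))) ∧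
            𝒟.toSpacetime.ConvergesToKerr 𝒟oc M' a' k ∧
            |M' - M| + |a' - a| ≤ C * (1 - (a / M) ^ 2) ^ (-p) *
              √(InitialDataSet.dataWeightedSobolevEDist s δ D (Kerr.data M a M hM.le)).toReal

/-- `BulkKerrCapture` at a FIXED package `(s, δ, k)` (route body verbatim otherwise). -/
def BulkKerrCaptureAt (s : ℕ) (δ : ℝ) (k : ℕ) : Prop :=
  ∀ [Kerr.Facts] [Kerr.SliceFacts], ∀ a₁ : ℝ, a₁ < 1 →
    ∀ (M : ℝ) (hM : 0 < M), ∃ ε > (0 : ℝ), ∃ C : ℝ, ∀ a : ℝ, |a| ≤ a₁ * M →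
      ∀ (D : InitialDataSet 𝓘(ℝ, E3) (Kerr.slice a M)) [D.metric.HasLeviCivita],
        D.IsVacuumConstraintSolution →
        InitialDataSet.dataWeightedSobolevEDist s δ D (Kerr.data M a M hM.le) <
          ENNReal.ofReal ε →
        ∀ 𝒟 : VacuumCauchyDevelopment D, 𝒟.IsMaximal →
          ∃ (M' a' : ℝ) (𝒟oc : Set 𝒟.carrier), Kerr.IsSubextremal M' a' ∧
            (∀ [𝒟.metric.HasLeviCivita], ∃ B₀ : Set (Kerr.slice a M), IsCompact B₀ ∧
              ∀ σ : ℝ, 0 < σ → ∃ B₁ : Set (Kerr.slice a M), IsCompact B₁ ∧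
                ∀ q ∈ {q : Kerr.slice a M | Kerr.afRadius a M + 1 ≤ ‖(q : E3)‖}, q ∉ B₁ →
                  ∀ (ray : ℝ → 𝒟.carrier) (dom : Set ℝ),
                    𝒟.metric.IsNormalisedNullRayFrom 𝒟.timeOrientation 𝒟.embed 𝒟.normal q ray
                      dom →
                    ¬ BddAbove dom ∨ ENNReal.ofReal σ ≤ sojournTime ray dom
                      (𝒟.metric.causalFuture 𝒟.timeOrientation (𝒟.embed '' B₀))) ∧
            𝒟.toSpacetime.ConvergesToKerr 𝒟oc M' a' k ∧
            |M' - M| + |a' - a| ≤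
              C * √(InitialDataSet.dataWeightedSobolevEDist s δ D (Kerr.data M a M hM.le)).toReal

/-- **The repaired crux `C′`**: the front end at a fixed exponent package. -/
def CaptureSufficesAt (s : ℕ) (δ : ℝ) (k : ℕ) (γ p : ℝ) : Prop :=
  NearExtremalKappaCaptureAt s δ k γ p → BulkKerrCaptureAt s δ k → WeakCosmicCensorshipMGHD →
    FinalStateConjecture

/-- The repaired near-extremal item implies the current one. -/
theorem near_of_nearAt {s : ℕ} {δ : ℝ} {k : ℕ} {γ p : ℝ} (h : NearExtremalKappaCaptureAt s δ k γ p) :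
    NearExtremalKappaCapture := by
  intro hF hSF
  obtain ⟨a₁, ha₁, H⟩ := @h hF hSF
  exact ⟨s, δ, k, γ, p, a₁, ha₁, H⟩

/-- The repaired bulk item implies the current one. -/
theorem bulk_of_bulkAt {s : ℕ} {δ : ℝ} {k : ℕ} (h : BulkKerrCaptureAt s δ k) : BulkKerrCapture := by
  intro hF hSF a₁ ha₁
  exact ⟨s, δ, k, @h hF hSF a₁ ha₁⟩

/-- **Nothing is lost by the repair**: the current crux implies the repaired crux at every package
(the repaired crux has STRONGER hypotheses). -/
theorem captureSufficesAt_of_captureSuffices (h : CaptureSuffices) (s : ℕ) (δ : ℝ) (k : ℕ) (γ p : ℝ) :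
    CaptureSufficesAt s δ k γ p :=
  fun hN hB hW ↦ h (near_of_nearAt hN) (bulk_of_bulkAt hB) hW


/-! ## §G (cycle 2) Naked and exposed-edge members of the basins: the kinematic ceiling `γ ≥ 1`

See part G of the module docstring. §G1 thresholds for the mass family at fixed spin; §G2 exponent
bookkeeping; §G3 the print-true hypotheses as named `Prop`s (`FarComplete` = the items' far-origin
sojourn clause verbatim, `VisibleEdgeIncomplete`, `MassFamilyLipschitz`) and the structural
theorems; §G4 corollaries for the fixed-package items of §F; §G5 the UNCONDITIONAL tightness side
(`dataWeightedSobolevEDist_kerr_ge`: an explicit lower bound `dist ≥ K'·|M − M'|` along the mass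
family for every `(s, δ)`, and `exists_const_basin_clears_visibleEdge`: for `γ ≥ 1` and
`c ≤ K'(M, δ)·M/2` no member of defect `≥ Mχ/2` is in the near-extremal basin, uniformly in the
spin). Landed (inline-hypothesis versions, no defs) as
`Theorems/CaptureSuffices/Negative/NakedMemberThresholds.lean` + `NakedMembers.lean` +
`NakedMemberTightness.lean`. -/

section NakedMembers

/-! ### §G1 Where the outer horizon of a member of the mass family sits relative to the slice edge -/

/-- **Horizon-below-edge criterion.** For `|a| < r₀`, the outer horizon radius
`Kerr.rPlus M' a = M' + √(M'² − a²)` of the Kerr–Schild spacetime `(M', a)` lies strictly below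
the truncation radius `r₀` of `Kerr.slice a r₀` iff `M' < (r₀² + a²)/(2r₀)` (for an overspinning
parameter `M' < |a|`: radicand negative, `Real.sqrt = 0`, `rPlus = M'`, and both sides hold). -/

theorem rPlus_lt_iff {M' a r₀ : ℝ} (hr : |a| < r₀) :
    Kerr.rPlus M' a < r₀ ↔ M' < (r₀ ^ 2 + a ^ 2) / (2 * r₀) := by
  have hr0 : 0 < r₀ := lt_of_le_of_lt (abs_nonneg a) hr
  have ha2 : a ^ 2 < r₀ ^ 2 := by nlinarith [abs_nonneg a, sq_abs a, hr]
  unfold Kerr.rPlus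
  rw [lt_div_iff₀ (by positivity)]
  constructor
  · intro h
    have hM'r : M' < r₀ := by nlinarith [Real.sqrt_nonneg (M' ^ 2 - a ^ 2)]
    have h2 : √(M' ^ 2 - a ^ 2) < r₀ - M' := by linarith
    rw [Real.sqrt_lt' (by linarith)] at h2
    nlinarith
  · intro h
    have hM'r : M' < r₀ := by nlinarith
    have h2 : √(M' ^ 2 - a ^ 2) < r₀ - M' := by
      rw [Real.sqrt_lt' (by linarith)]
      nlinarith
    linarith

/-- At the items' truncation radius `r₀ = M` the threshold is `(M² + a²)/(2M) = M − Mχ/2`,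
`χ = 1 − (a/M)²`: a member's outer horizon drops below the slice edge exactly when its mass
defect exceeds `Mχ/2`. -/
theorem edge_threshold_eq {M : ℝ} (hM : M ≠ 0) (a : ℝ) :
    (M ^ 2 + a ^ 2) / (2 * M) = M - M * (1 - (a / M) ^ 2) / 2 := by
  field_simp
  ring

/-- The exposed-edge SUB-extremal window `(|a|, (M² + a²)/(2M))` is non-empty for every
sub-extremal `(M, a)`: `(M² + a²)/(2M) − |a| = (M − |a|)²/(2M) > 0`. -/
theorem abs_lt_edge_threshold {M a : ℝ} (hM : 0 < M) (h : Kerr.IsSubextremal M a) :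
    |a| < (M ^ 2 + a ^ 2) / (2 * M) := by
  unfold Kerr.IsSubextremal at h
  rw [lt_div_iff₀ (by positivity)]
  nlinarith [sq_pos_of_pos (sub_pos.2 h), sq_abs a, abs_nonneg a]

/-- The extremal member `M' = |a|` (start of the naked segment) sits at mass defect
`M − |a| ∈ [Mχ/2, Mχ]`. -/
theorem defect_extremal_bounds {M a : ℝ} (hM : 0 < M) (ha : |a| ≤ M) :
    M * (1 - (a / M) ^ 2) ≤ 2 * (M - |a|) ∧ M - |a| ≤ M * (1 - (a / M) ^ 2) := by
  have hb := abs_nonneg a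
  have e : M * (1 - (a / M) ^ 2) = (M - |a|) * (M + |a|) / M := by
    have : (a / M) ^ 2 = |a| ^ 2 / M ^ 2 := by rw [div_pow, sq_abs]
    rw [this]
    field_simp
    ring
  rw [e, div_le_iff₀ hM, le_div_iff₀ hM]
  constructor
  · nlinarith [sq_nonneg (M - |a|)]
  · nlinarith [mul_nonneg (sub_nonneg.2 ha) hb]

/-! ### §G2 Exponent bookkeeping: `γ < 1` swallows the naked segment, `γ ≥ 1` can avoid it -/

/-- **`γ < 1`: every basin `c·χ^γ` eventually swallows members at distance `≍ χ`** — for all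
`K, c > 0` there are arbitrarily small `χ ∈ (0, 1]` with `K·χ < c·χ^γ`. -/

theorem exists_chi_linear_lt_rpow {γ : ℝ} (hγ : γ < 1) {K c χ₀ : ℝ} (hK : 0 < K) (hc : 0 < c)
    (hχ₀ : 0 < χ₀) : ∃ χ : ℝ, 0 < χ ∧ χ < χ₀ ∧ χ ≤ 1 ∧ K * χ < c * χ ^ γ := by
  have h1γ : 0 < 1 - γ := by linarith
  set t : ℝ := (c / (2 * K)) ^ (1 - γ)⁻¹ with ht
  have ht0 : 0 < t := Real.rpow_pos_of_pos (by positivity) _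
  set χ : ℝ := min (χ₀ / 2) (min 1 t) with hχ
  have hχ0 : 0 < χ := lt_min (by positivity) (lt_min one_pos ht0)
  refine ⟨χ, hχ0, lt_of_le_of_lt (min_le_left _ _) (by linarith),
    le_trans (min_le_right _ _) (min_le_left _ _), ?_⟩
  have hχt : χ ≤ t := le_trans (min_le_right _ _) (min_le_right _ _)
  have hpow : χ ^ (1 - γ) ≤ c / (2 * K) := by
    calc χ ^ (1 - γ) ≤ t ^ (1 - γ) := Real.rpow_le_rpow hχ0.le hχt h1γ.le
      _ = c / (2 * K) := by rw [ht, Real.rpow_inv_rpow (by positivity) h1γ.ne']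
  have hsplit : χ ^ (1 - γ) * χ ^ γ = χ := by
    rw [← Real.rpow_add hχ0]
    simp
  have hχγ : 0 < χ ^ γ := Real.rpow_pos_of_pos hχ0 _
  have hcχ : 0 < c * χ ^ γ := mul_pos hc hχγ
  calc K * χ = (K * χ ^ (1 - γ)) * χ ^ γ := by rw [mul_assoc, hsplit]
    _ ≤ (K * (c / (2 * K))) * χ ^ γ := by gcongr
    _ = (c / 2) * χ ^ γ := by field_simp
    _ < c * χ ^ γ := by linarith

/-- **`γ ≥ 1`: a small constant clears the threshold** (tightness of the ceiling inside the mass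
family): `c ≤ K'M/2`, `0 < χ ≤ 1` ⇒ `c·χ^γ ≤ K'·(Mχ/2)`. -/
theorem basin_le_half_defect_of_one_le {γ : ℝ} (hγ : 1 ≤ γ) {c K' M χ : ℝ} (hc : 0 ≤ c)
    (hcK : c ≤ K' * M / 2) (hχ0 : 0 < χ) (hχ1 : χ ≤ 1) : c * χ ^ γ ≤ K' * (M * χ / 2) := by
  have h1 : χ ^ γ ≤ χ := by
    calc χ ^ γ ≤ χ ^ (1 : ℝ) := Real.rpow_le_rpow_of_exponent_ge hχ0 hχ1 hγ
      _ = χ := Real.rpow_one χ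
  calc c * χ ^ γ ≤ c * χ := mul_le_mul_of_nonneg_left h1 hc
    _ ≤ K' * M / 2 * χ := mul_le_mul_of_nonneg_right hcK hχ0.le
    _ = K' * (M * χ / 2) := by ring

/-! ### §G3 The print-true hypotheses and the structural theorems -/

/-- The far-origin sojourn-completeness clause of items 10606 / 10696, VERBATIM (with `M ↦ r₀`),
for a vacuum Cauchy development `𝒟` of data on `Kerr.slice a r₀`. -/
def FarComplete [Kerr.SliceFacts] {a r₀ : ℝ} {D : InitialDataSet 𝓘(ℝ, E3) (Kerr.slice a r₀)}
    (𝒟 : VacuumCauchyDevelopment D) : Prop :=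
  ∀ [𝒟.metric.HasLeviCivita], ∃ B₀ : Set (Kerr.slice a r₀), IsCompact B₀ ∧
    ∀ σ : ℝ, 0 < σ → ∃ B₁ : Set (Kerr.slice a r₀), IsCompact B₁ ∧
      ∀ q ∈ {q : Kerr.slice a r₀ | Kerr.afRadius a r₀ + 1 ≤ ‖(q : E3)‖}, q ∉ B₁ →
        ∀ (ray : ℝ → 𝒟.carrier) (dom : Set ℝ),
          𝒟.metric.IsNormalisedNullRayFrom 𝒟.timeOrientation 𝒟.embed 𝒟.normal q ray dom →
          ¬ BddAbove dom ∨ ENNReal.ofReal σ ≤ sojournTime ray dom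
            (𝒟.metric.causalFuture 𝒟.timeOrientation (𝒟.embed '' B₀))

/-- **Visible edge ⇒ no far-complete MGHD** (print-true, not constructible here): for `0 ≤ M'` and
either `M' < |a|`, `0 < r₀` (overspinning: no horizon) or `|a| ≤ M'`, `Kerr.rPlus M' a < r₀` (outer
horizon strictly below the slice edge), no maximal vacuum Cauchy development of the member
`Kerr.data M' a r₀` is far-complete. Print: the MGHD is the domain of dependence of the truncated
slice in the Kerr–Schild spacetime (Choquet-Bruhat–Geroch 1969; Ringström 2009 Thm 16.6); its
future Cauchy horizon is ruled by null geodesics from the edge 2-sphere (Hawking–Ellis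
Prop. 6.5.3) and reaches large radii at bounded retarded time; ingoing far rays leave after
bounded sojourn (the computation recorded in `NullInfinity.lean`, Dafermos CQG 22 (2005) §1).
[cite: Ringstrom2009, Thm. 16.6] [cite: HawkingEllis1973, Prop. 6.5.3] -/
def VisibleEdgeIncomplete [Kerr.Facts] [Kerr.SliceFacts] : Prop :=
  ∀ (M' a r₀ : ℝ) (hM' : 0 ≤ M'), (M' < |a| ∧ 0 < r₀ ∨ |a| ≤ M' ∧ Kerr.rPlus M' a < r₀) →
    ∀ 𝒟 : VacuumCauchyDevelopment (Kerr.data M' a r₀ hM'), 𝒟.IsMaximal → ¬ FarComplete 𝒟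

/-- **Lipschitz dependence of the `(s, δ)` data distance on the mass along the family**, with a
constant `K M` uniform in the spin `|a| < M` and in `M' ∈ [0, M]` (print: TRUE iff `δ < -1/2` —
`h` is affine in the mass with `m`-th derivatives `O(|ΔM| r^{-1-m})`, `k` smooth in it with
`O(|ΔM| r^{-2-m})`, smooth up to the edge and continuous in `a` up to `|a| = M`; FALSE for
`δ ≥ -1/2` by §D, where the distance is `⊤`). -/
def MassFamilyLipschitz [Kerr.Facts] [Kerr.SliceFacts] (s : ℕ) (δ : ℝ) (K : ℝ → ℝ) : Prop :=
  ∀ (M : ℝ) (hM : 0 < M) (a : ℝ), |a| < M → ∀ (M' : ℝ) (hM' : 0 ≤ M'), M' ≤ M →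
    InitialDataSet.dataWeightedSobolevEDist s δ (Kerr.data M' a M hM') (Kerr.data M a M hM.le) ≤
      ENNReal.ofReal (K M * (M - M'))

/-- **The inner clause of `NearExtremalKappaCapture` is false for every package with `γ < 1`**
(every `M > 0`, `a₁ < 1`, `c > 0`, `C`), modulo `hmghd`, `hvac`, `VisibleEdgeIncomplete`,
`MassFamilyLipschitz s δ K`. The negated clause is VERBATIM the body of item 10606 after its prefix
`∃ (s δ k γ p a₁), a₁ < 1 ∧ ∀ M > 0, ∃ c > 0, ∃ C`. Witness: spin `a = M√(1 − χ)` (`1 − (a/M)² = χ`),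
the overspinning member of mass `M(1 − χ)`, at distance `≤ K(M)·Mχ < c·χ^γ` for small `χ`. -/
theorem near_inner_false_of_gamma_lt_one [Kerr.Facts] [Kerr.SliceFacts]
    (hmghd : choquetBruhat_geroch_exists_mghd_cauchy)
    (hvac : ∀ M' a r₀ : ℝ, Kerr.data_isVacuumConstraintSolution M' a r₀)
    (hedge : VisibleEdgeIncomplete)
    {s : ℕ} {δ : ℝ} {K : ℝ → ℝ} (hK : MassFamilyLipschitz s δ K)
    {k : ℕ} {γ p a₁ : ℝ} (ha₁ : a₁ < 1) (hγ : γ < 1) {M : ℝ} (hM : 0 < M) {c : ℝ} (hc : 0 < c)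
    (C : ℝ) :
    ¬ (∀ a : ℝ, a₁ * M ≤ |a| → Kerr.IsSubextremal M a →
        ∀ (D : InitialDataSet 𝓘(ℝ, E3) (Kerr.slice a M)) [D.metric.HasLeviCivita],
          D.IsVacuumConstraintSolution →
          InitialDataSet.dataWeightedSobolevEDist s δ D (Kerr.data M a M hM.le) <
            ENNReal.ofReal (c * (1 - (a / M) ^ 2) ^ γ) →
          ∀ 𝒟 : VacuumCauchyDevelopment D, 𝒟.IsMaximal →
            ∃ (M' a' : ℝ) (𝒟oc : Set 𝒟.carrier), Kerr.IsSubextremal M' a' ∧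
              (∀ [𝒟.metric.HasLeviCivita], ∃ B₀ : Set (Kerr.slice a M), IsCompact B₀ ∧
                ∀ σ : ℝ, 0 < σ → ∃ B₁ : Set (Kerr.slice a M), IsCompact B₁ ∧
                  ∀ q ∈ {q : Kerr.slice a M | Kerr.afRadius a M + 1 ≤ ‖(q : E3)‖}, q ∉ B₁ →
                    ∀ (ray : ℝ → 𝒟.carrier) (dom : Set ℝ),
                      𝒟.metric.IsNormalisedNullRayFrom 𝒟.timeOrientation 𝒟.embed 𝒟.normal q ray
                        dom →
                      ¬ BddAbove dom ∨ ENNReal.ofReal σ ≤ sojournTime ray dom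
                        (𝒟.metric.causalFuture 𝒟.timeOrientation (𝒟.embed '' B₀))) ∧
              𝒟.toSpacetime.ConvergesToKerr 𝒟oc M' a' k ∧
              |M' - M| + |a' - a| ≤ C * (1 - (a / M) ^ 2) ^ (-p) *
                √(InitialDataSet.dataWeightedSobolevEDist s δ D (Kerr.data M a M hM.le)).toReal) := by
  intro H
  set K₁ : ℝ := max (K M) 1 with hK₁
  have hK₁0 : 0 < K₁ := lt_of_lt_of_le one_pos (le_max_right _ _)
  have hm0 : 0 ≤ max a₁ 0 := le_max_right _ _
  have hm1 : max a₁ 0 < 1 := max_lt ha₁ one_pos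
  have hχ₀ : 0 < 1 - (max a₁ 0) ^ 2 := by nlinarith
  obtain ⟨χ, hχ0, hχlt, hχ1, hineq⟩ := exists_chi_linear_lt_rpow hγ (mul_pos hK₁0 hM) hc hχ₀
  have hχlt1 : χ < 1 := by nlinarith [sq_nonneg (max a₁ 0)]
  set a : ℝ := M * √(1 - χ) with ha_def
  set M' : ℝ := M * (1 - χ) with hM'_def
  have hsq : √(1 - χ) ^ 2 = 1 - χ := Real.sq_sqrt (by linarith)
  have hs0 : 0 ≤ √(1 - χ) := Real.sqrt_nonneg _
  have hs1 : √(1 - χ) < 1 := by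
    rw [Real.sqrt_lt' one_pos]
    linarith
  have hslt : 1 - χ < √(1 - χ) := by
    rw [Real.lt_sqrt (by linarith)]
    nlinarith
  have hsm : max a₁ 0 ≤ √(1 - χ) := by
    rw [Real.le_sqrt hm0 (by linarith)]
    linarith
  have ha_abs : |a| = M * √(1 - χ) := by
    rw [ha_def, abs_mul, abs_of_pos hM, abs_of_nonneg hs0]
  have hM'0 : 0 ≤ M' := mul_nonneg hM.le (by linarith)
  have hM'le : M' ≤ M := by
    rw [hM'_def]
    nlinarith
  have hsub : Kerr.IsSubextremal M a := by
    show |a| < M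
    rw [ha_abs]
    exact mul_lt_of_lt_one_right hM hs1
  have harange : a₁ * M ≤ |a| := by
    rw [ha_abs]
    calc a₁ * M ≤ max a₁ 0 * M := mul_le_mul_of_nonneg_right (le_max_left _ _) hM.le
      _ ≤ √(1 - χ) * M := mul_le_mul_of_nonneg_right hsm hM.le
      _ = M * √(1 - χ) := mul_comm _ _
  have hnak : M' < |a| := by
    rw [ha_abs, hM'_def]
    exact mul_lt_mul_of_pos_left hslt hM
  have hdiv : a / M = √(1 - χ) := by
    rw [ha_def]
    field_simp
  have hchi : 1 - (a / M) ^ 2 = χ := by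
    rw [hdiv, hsq]
    ring
  set D := Kerr.data M' a M hM'0 with hD
  haveI : D.metric.HasLeviCivita := D.metric.hasLeviCivita
  have hvacD : D.IsVacuumConstraintSolution := hvac M' a M hM'0
  have hdist : InitialDataSet.dataWeightedSobolevEDist s δ D (Kerr.data M a M hM.le) <
      ENNReal.ofReal (c * (1 - (a / M) ^ 2) ^ γ) := by
    refine lt_of_le_of_lt (hK M hM a hsub M' hM'0 hM'le) ?_
    rw [hchi, ENNReal.ofReal_lt_ofReal_iff (mul_pos hc (Real.rpow_pos_of_pos hχ0 γ))]
    have hMM' : M - M' = M * χ := by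
      rw [hM'_def]
      ring
    rw [hMM']
    calc K M * (M * χ) ≤ K₁ * (M * χ) :=
          mul_le_mul_of_nonneg_right (le_max_left _ _) (by positivity)
      _ = K₁ * M * χ := by ring
      _ < c * χ ^ γ := hineq
  obtain ⟨𝒟, h𝒟⟩ := hmghd (Kerr.slice a M) D hvacD
  obtain ⟨M'', a'', 𝒟oc, -, hfar, -, -⟩ := H a harange hsub D hvacD hdist 𝒟 h𝒟
  exact hedge M' a M hM'0 (Or.inl ⟨hnak, hM⟩) 𝒟 h𝒟 hfar

/-- **The inner clause of `BulkKerrCapture` is false for every `ε > K(M)·M(1 − a₁²)/2`**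
(`0 ≤ a₁ < 1`, `0 < K M`), modulo the same hypotheses. The negated clause is VERBATIM the body of
item 10696 after its prefix `∀ a₁ < 1, ∃ (s δ k), ∀ M > 0, ∃ ε > 0, ∃ C`. Witness: spin `a = a₁M`,
the exposed-edge sub-extremal member of mass `(M² + a²)/(2M) − τ`, `τ > 0` small. -/
theorem bulk_inner_false_of_threshold_lt [Kerr.Facts] [Kerr.SliceFacts]
    (hmghd : choquetBruhat_geroch_exists_mghd_cauchy)
    (hvac : ∀ M' a r₀ : ℝ, Kerr.data_isVacuumConstraintSolution M' a r₀)
    (hedge : VisibleEdgeIncomplete)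
    {s : ℕ} {δ : ℝ} {K : ℝ → ℝ} (hK : MassFamilyLipschitz s δ K)
    {k : ℕ} {a₁ : ℝ} (ha₁0 : 0 ≤ a₁) (ha₁ : a₁ < 1) {M : ℝ} (hM : 0 < M) (hKM : 0 < K M)
    {ε : ℝ} (C : ℝ) (hε : K M * (M * (1 - a₁ ^ 2) / 2) < ε) :
    ¬ (∀ a : ℝ, |a| ≤ a₁ * M →
        ∀ (D : InitialDataSet 𝓘(ℝ, E3) (Kerr.slice a M)) [D.metric.HasLeviCivita],
          D.IsVacuumConstraintSolution →
          InitialDataSet.dataWeightedSobolevEDist s δ D (Kerr.data M a M hM.le) <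
            ENNReal.ofReal ε →
          ∀ 𝒟 : VacuumCauchyDevelopment D, 𝒟.IsMaximal →
            ∃ (M' a' : ℝ) (𝒟oc : Set 𝒟.carrier), Kerr.IsSubextremal M' a' ∧
              (∀ [𝒟.metric.HasLeviCivita], ∃ B₀ : Set (Kerr.slice a M), IsCompact B₀ ∧
                ∀ σ : ℝ, 0 < σ → ∃ B₁ : Set (Kerr.slice a M), IsCompact B₁ ∧
                  ∀ q ∈ {q : Kerr.slice a M | Kerr.afRadius a M + 1 ≤ ‖(q : E3)‖}, q ∉ B₁ →
                    ∀ (ray : ℝ → 𝒟.carrier) (dom : Set ℝ),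
                      𝒟.metric.IsNormalisedNullRayFrom 𝒟.timeOrientation 𝒟.embed 𝒟.normal q ray
                        dom →
                      ¬ BddAbove dom ∨ ENNReal.ofReal σ ≤ sojournTime ray dom
                        (𝒟.metric.causalFuture 𝒟.timeOrientation (𝒟.embed '' B₀))) ∧
              𝒟.toSpacetime.ConvergesToKerr 𝒟oc M' a' k ∧
              |M' - M| + |a' - a| ≤
                C * √(InitialDataSet.dataWeightedSobolevEDist s δ D (Kerr.data M a M hM.le)).toReal) := by
  intro H
  set a : ℝ := a₁ * M with ha_def
  have ha0 : 0 ≤ a := mul_nonneg ha₁0 hM.le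
  have ha_abs : |a| = a₁ * M := abs_of_nonneg ha0
  have haM : |a| < M := by
    rw [ha_abs]
    exact mul_lt_of_lt_one_left hM ha₁
  set d : ℝ := M * (1 - a₁ ^ 2) / 2 with hd_def
  have ha1sq : a₁ ^ 2 < 1 := by nlinarith
  have hd0 : 0 < d := by
    rw [hd_def]
    have : 0 < 1 - a₁ ^ 2 := by linarith
    positivity
  have hgap : 0 < M * (1 - a₁) ^ 2 / 4 := by
    have : 0 < (1 - a₁) ^ 2 := by nlinarith
    positivity
  set τ : ℝ := min ((ε - K M * d) / (2 * K M)) (M * (1 - a₁) ^ 2 / 4) with hτ_def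
  have hτ0 : 0 < τ := lt_min (div_pos (by linarith) (by positivity)) hgap
  have hτ1 : τ ≤ (ε - K M * d) / (2 * K M) := min_le_left _ _
  have hτ2 : τ ≤ M * (1 - a₁) ^ 2 / 4 := min_le_right _ _
  set M' : ℝ := (M ^ 2 + a ^ 2) / (2 * M) - τ with hM'_def
  have hthr : (M ^ 2 + a ^ 2) / (2 * M) = M - d := by
    rw [hd_def, ha_def]
    field_simp
    ring
  have hM'eq : M' = M - d - τ := by rw [hM'_def, hthr]
  have haM' : |a| ≤ M' := by
    rw [ha_abs, hM'eq, hd_def]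
    nlinarith
  have hM'0 : 0 ≤ M' := le_trans (abs_nonneg a) haM'
  have hM'le : M' ≤ M := by
    rw [hM'eq]
    linarith
  have hrplus : Kerr.rPlus M' a < M := by
    rw [rPlus_lt_iff haM, hM'_def]
    linarith
  set D := Kerr.data M' a M hM'0 with hD
  haveI : D.metric.HasLeviCivita := D.metric.hasLeviCivita
  have hvacD : D.IsVacuumConstraintSolution := hvac M' a M hM'0
  have hdist : InitialDataSet.dataWeightedSobolevEDist s δ D (Kerr.data M a M hM.le) <
      ENNReal.ofReal ε := by
    refine lt_of_le_of_lt (hK M hM a haM M' hM'0 hM'le) ?_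
    rw [ENNReal.ofReal_lt_ofReal_iff (lt_trans (mul_pos hKM hd0) hε)]
    have hMM' : M - M' = d + τ := by
      rw [hM'eq]
      ring
    rw [hMM']
    have h1 : K M * τ ≤ (ε - K M * d) / 2 := by
      calc K M * τ ≤ K M * ((ε - K M * d) / (2 * K M)) := mul_le_mul_of_nonneg_left hτ1 hKM.le
        _ = (ε - K M * d) / 2 := by field_simp
    nlinarith
  obtain ⟨𝒟, h𝒟⟩ := hmghd (Kerr.slice a M) D hvacD
  obtain ⟨M'', a'', 𝒟oc, -, hfar, -, -⟩ := H a (le_of_eq ha_abs) D hvacD hdist 𝒟 h𝒟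
  exact hedge M' a M hM'0 (Or.inr ⟨haM', hrplus⟩) 𝒟 h𝒟 hfar

/-! ### §G4 Corollaries for the fixed-package items of §F -/

/-- **Any true fixed-package near-extremal item has `γ ≥ 1`** (in a topology where the mass family
is Lipschitz, i.e. un-pinned), modulo the print-true hypotheses of §G3. -/
theorem nearExtremalKappaCaptureAt_forces_one_le_gamma [Kerr.Facts] [Kerr.SliceFacts]
    (hmghd : choquetBruhat_geroch_exists_mghd_cauchy)
    (hvac : ∀ M' a r₀ : ℝ, Kerr.data_isVacuumConstraintSolution M' a r₀)
    (hedge : VisibleEdgeIncomplete) {s : ℕ} {δ : ℝ} {K : ℝ → ℝ} (hK : MassFamilyLipschitz s δ K)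
    {k : ℕ} {γ p : ℝ} (h : NearExtremalKappaCaptureAt s δ k γ p) : 1 ≤ γ := by
  by_contra hγ
  rw [not_le] at hγ
  obtain ⟨a₁, ha₁, H⟩ := @h ‹Kerr.Facts› ‹Kerr.SliceFacts›
  obtain ⟨c, hc, C, HC⟩ := H 1 one_pos
  exact near_inner_false_of_gamma_lt_one hmghd hvac hedge hK ha₁ hγ one_pos hc C HC

/-- **The route decl itself: any witnessing package of `NearExtremalKappaCapture` has `γ ≥ 1`
unless its `(s, δ)` topology is one in which the mass family is not Lipschitz (i.e. a mass-pinning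
one, §D)** — modulo the print-true hypotheses of §G3. The body is VERBATIM item 10606's. -/
theorem nearExtremalKappaCapture_witness_one_le_gamma [Kerr.Facts] [Kerr.SliceFacts]
    (hmghd : choquetBruhat_geroch_exists_mghd_cauchy)
    (hvac : ∀ M' a r₀ : ℝ, Kerr.data_isVacuumConstraintSolution M' a r₀)
    (hedge : VisibleEdgeIncomplete) (h : NearExtremalKappaCapture) :
    ∃ (s : ℕ) (δ : ℝ) (k : ℕ) (γ p a₁ : ℝ),
      (∀ K : ℝ → ℝ, MassFamilyLipschitz s δ K → 1 ≤ γ) ∧ a₁ < 1 ∧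
      ∀ (M : ℝ) (hM : 0 < M), ∃ c > (0 : ℝ), ∃ C : ℝ, ∀ a : ℝ, a₁ * M ≤ |a| →
        Kerr.IsSubextremal M a →
        ∀ (D : InitialDataSet 𝓘(ℝ, E3) (Kerr.slice a M)) [D.metric.HasLeviCivita],
          D.IsVacuumConstraintSolution →
          InitialDataSet.dataWeightedSobolevEDist s δ D (Kerr.data M a M hM.le) <
            ENNReal.ofReal (c * (1 - (a / M) ^ 2) ^ γ) →
          ∀ 𝒟 : VacuumCauchyDevelopment D, 𝒟.IsMaximal →
            ∃ (M' a' : ℝ) (𝒟oc : Set 𝒟.carrier), Kerr.IsSubextremal M' a' ∧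
              (∀ [𝒟.metric.HasLeviCivita], ∃ B₀ : Set (Kerr.slice a M), IsCompact B₀ ∧
                ∀ σ : ℝ, 0 < σ → ∃ B₁ : Set (Kerr.slice a M), IsCompact B₁ ∧
                  ∀ q ∈ {q : Kerr.slice a M | Kerr.afRadius a M + 1 ≤ ‖(q : E3)‖}, q ∉ B₁ →
                    ∀ (ray : ℝ → 𝒟.carrier) (dom : Set ℝ),
                      𝒟.metric.IsNormalisedNullRayFrom 𝒟.timeOrientation 𝒟.embed 𝒟.normal q ray
                        dom →
                      ¬ BddAbove dom ∨ ENNReal.ofReal σ ≤ sojournTime ray dom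
                        (𝒟.metric.causalFuture 𝒟.timeOrientation (𝒟.embed '' B₀))) ∧
              𝒟.toSpacetime.ConvergesToKerr 𝒟oc M' a' k ∧
              |M' - M| + |a' - a| ≤ C * (1 - (a / M) ^ 2) ^ (-p) *
                √(InitialDataSet.dataWeightedSobolevEDist s δ D (Kerr.data M a M hM.le)).toReal := by
  obtain ⟨s, δ, k, γ, p, a₁, ha₁, H⟩ := @h ‹Kerr.Facts› ‹Kerr.SliceFacts›
  refine ⟨s, δ, k, γ, p, a₁, fun K hK ↦ ?_, ha₁, H⟩
  by_contra hγ
  rw [not_le] at hγ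
  obtain ⟨c, hc, C, HC⟩ := H 1 one_pos
  exact near_inner_false_of_gamma_lt_one hmghd hvac hedge hK ha₁ hγ one_pos hc C HC

/-- **Every basin radius witnessing the bulk clause is at most `K(M)·M(1 − a₁²)/2`** (contrapositive
of `bulk_inner_false_of_threshold_lt`; the clause is VERBATIM the body of item 10696 / of
`BulkKerrCaptureAt` after `∃ ε > 0, ∃ C`). -/
theorem bulk_eps_le_threshold [Kerr.Facts] [Kerr.SliceFacts]
    (hmghd : choquetBruhat_geroch_exists_mghd_cauchy)
    (hvac : ∀ M' a r₀ : ℝ, Kerr.data_isVacuumConstraintSolution M' a r₀)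
    (hedge : VisibleEdgeIncomplete) {s : ℕ} {δ : ℝ} {K : ℝ → ℝ} (hK : MassFamilyLipschitz s δ K)
    {k : ℕ} {a₁ : ℝ} (ha₁0 : 0 ≤ a₁) (ha₁ : a₁ < 1) {M : ℝ} (hM : 0 < M) (hKM : 0 < K M)
    {ε : ℝ} (C : ℝ)
    (H : ∀ a : ℝ, |a| ≤ a₁ * M →
        ∀ (D : InitialDataSet 𝓘(ℝ, E3) (Kerr.slice a M)) [D.metric.HasLeviCivita],
          D.IsVacuumConstraintSolution →
          InitialDataSet.dataWeightedSobolevEDist s δ D (Kerr.data M a M hM.le) <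
            ENNReal.ofReal ε →
          ∀ 𝒟 : VacuumCauchyDevelopment D, 𝒟.IsMaximal →
            ∃ (M' a' : ℝ) (𝒟oc : Set 𝒟.carrier), Kerr.IsSubextremal M' a' ∧
              (∀ [𝒟.metric.HasLeviCivita], ∃ B₀ : Set (Kerr.slice a M), IsCompact B₀ ∧
                ∀ σ : ℝ, 0 < σ → ∃ B₁ : Set (Kerr.slice a M), IsCompact B₁ ∧
                  ∀ q ∈ {q : Kerr.slice a M | Kerr.afRadius a M + 1 ≤ ‖(q : E3)‖}, q ∉ B₁ →
                    ∀ (ray : ℝ → 𝒟.carrier) (dom : Set ℝ),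
                      𝒟.metric.IsNormalisedNullRayFrom 𝒟.timeOrientation 𝒟.embed 𝒟.normal q ray
                        dom →
                      ¬ BddAbove dom ∨ ENNReal.ofReal σ ≤ sojournTime ray dom
                        (𝒟.metric.causalFuture 𝒟.timeOrientation (𝒟.embed '' B₀))) ∧
              𝒟.toSpacetime.ConvergesToKerr 𝒟oc M' a' k ∧
              |M' - M| + |a' - a| ≤
                C * √(InitialDataSet.dataWeightedSobolevEDist s δ D (Kerr.data M a M hM.le)).toReal) :
    ε ≤ K M * (M * (1 - a₁ ^ 2) / 2) :=
  le_of_not_gt fun hlt ↦ bulk_inner_false_of_threshold_lt hmghd hvac hedge hK ha₁0 ha₁ hM hKM C hlt H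

/-- The bulk item of §F at a fixed package has, at every `(a₁, M)` with `0 ≤ a₁`, a witnessing basin
radius of size at most `K(M)·M(1 − a₁²)/2`. -/
theorem bulkKerrCaptureAt_basin_le [Kerr.Facts] [Kerr.SliceFacts]
    (hmghd : choquetBruhat_geroch_exists_mghd_cauchy)
    (hvac : ∀ M' a r₀ : ℝ, Kerr.data_isVacuumConstraintSolution M' a r₀)
    (hedge : VisibleEdgeIncomplete) {s : ℕ} {δ : ℝ} {K : ℝ → ℝ} (hK : MassFamilyLipschitz s δ K)
    (hKpos : ∀ M : ℝ, 0 < M → 0 < K M) {k : ℕ} (h : BulkKerrCaptureAt s δ k) {a₁ : ℝ}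
    (ha₁0 : 0 ≤ a₁) (ha₁ : a₁ < 1) {M : ℝ} (hM : 0 < M) :
    ∃ ε : ℝ, 0 < ε ∧ ε ≤ K M * (M * (1 - a₁ ^ 2) / 2) := by
  obtain ⟨ε, hε, C, HC⟩ := @h ‹Kerr.Facts› ‹Kerr.SliceFacts› a₁ ha₁ M hM
  exact ⟨ε, hε, bulk_eps_le_threshold hmghd hvac hedge hK ha₁0 ha₁ hM (hKpos M hM) C HC⟩

/-! ### §G5 Tightness, unconditionally: a lower bound on the distance along the mass family -/

/-- Shell lower bound: a function `≥ κ` on the dyadic shell `{R < ‖y‖ ≤ 2R} ⊆ U` has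
`∫_U f ≥ 7R³κ·|B₁|`. -/
theorem setLIntegral_ge_shell {κ R : ℝ} (hR : 0 < R) {U : Set E3}
    (hU : {y : E3 | R < ‖y‖} ⊆ U) {f : E3 → ℝ≥0∞}
    (hf : ∀ y : E3, R < ‖y‖ → ‖y‖ ≤ 2 * R → ENNReal.ofReal κ ≤ f y) :
    ENNReal.ofReal (7 * R ^ 3 * κ) * volume (Metric.ball (0 : E3) 1) ≤ ∫⁻ y in U, f y := by
  set b : ℝ≥0∞ := volume (Metric.ball (0 : E3) 1) with hb
  have hbtop : b ≠ ⊤ := measure_ball_lt_top.ne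
  set A : Set E3 := Metric.closedBall 0 (2 * R) \ Metric.closedBall 0 R with hA
  have hAU : A ⊆ U := fun y hy ↦ hU (lt_of_not_ge fun h ↦ hy.2 (mem_closedBall_zero_iff.2 h))
  have hAm : MeasurableSet A := measurableSet_closedBall.diff measurableSet_closedBall
  have hfA : ∀ y ∈ A, ENNReal.ofReal κ ≤ f y := fun y hy ↦
    hf y (lt_of_not_ge fun h ↦ hy.2 (mem_closedBall_zero_iff.2 h)) (mem_closedBall_zero_iff.1 hy.1)
  have hvol : ENNReal.ofReal (7 * R ^ 3) * b ≤ volume A := by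
    have h1 : volume (Metric.closedBall (0 : E3) (2 * R)) = ENNReal.ofReal ((2 * R) ^ 3) * b := by
      rw [Measure.addHaar_closedBall volume (0 : E3) (by positivity : (0 : ℝ) ≤ 2 * R),
        finrank_euclideanSpace_fin]
    have h2 : volume (Metric.closedBall (0 : E3) R) = ENNReal.ofReal (R ^ 3) * b := by
      rw [Measure.addHaar_closedBall volume (0 : E3) hR.le, finrank_euclideanSpace_fin]
    calc ENNReal.ofReal (7 * R ^ 3) * b
        = ENNReal.ofReal ((2 * R) ^ 3 - R ^ 3) * b := by congr 1; ring_nf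
      _ = (ENNReal.ofReal ((2 * R) ^ 3) - ENNReal.ofReal (R ^ 3)) * b := by
          rw [ENNReal.ofReal_sub _ (by positivity)]
      _ = ENNReal.ofReal ((2 * R) ^ 3) * b - ENNReal.ofReal (R ^ 3) * b := by
          rw [ENNReal.sub_mul fun _ _ ↦ hbtop]
      _ = volume (Metric.closedBall (0 : E3) (2 * R)) - volume (Metric.closedBall (0 : E3) R) := by
          rw [h1, h2]
      _ ≤ volume A := le_measure_sdiff
  calc ENNReal.ofReal (7 * R ^ 3 * κ) * b
      = ENNReal.ofReal (7 * R ^ 3) * ENNReal.ofReal κ * b := by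
        rw [ENNReal.ofReal_mul (by positivity)]
    _ = ENNReal.ofReal κ * (ENNReal.ofReal (7 * R ^ 3) * b) := by ring
    _ ≤ ENNReal.ofReal κ * volume A := mul_le_mul' le_rfl hvol
    _ = ∫⁻ _ in A, ENNReal.ofReal κ := (setLIntegral_const A _).symm
    _ ≤ ∫⁻ y in A, f y := setLIntegral_mono' hAm hfA
    _ ≤ ∫⁻ y in U, f y := lintegral_mono_set hAU

/-- **Unconditional lower bound along the mass family** (every `s`, every `δ`): with
`R ≥ Kerr.afRadius a r₀ + 2|a|` and `w = min 1 ((1 + 2R)^{2δ})`,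
`dist_{s,δ}(Kerr.data M a r₀, Kerr.data M' a r₀)² ≥ 7R³ · w · (M − M')²/(2R)² · |B₁|`
(the `m = 0` term of the `h`-part over the dyadic shell `{R < ‖y‖ ≤ 2R}`, where the pointwise
bound `‖h_M − h_{M'}‖ ≥ |M − M'|/‖y‖` of `KerrMassPinning.lean` holds). -/
theorem dataWeightedSobolevEDist_kerr_ge [Kerr.Facts] [Kerr.SliceFacts] {M M' : ℝ} (hM : 0 ≤ M)
    (hM' : 0 ≤ M') (a r₀ : ℝ) (s : ℕ) (δ : ℝ) {R : ℝ} (hR : Kerr.afRadius a r₀ + 2 * |a| ≤ R) :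
    (ENNReal.ofReal (7 * R ^ 3 * (min 1 ((1 + 2 * R) ^ (2 * δ)) * ((M - M') ^ 2 / (2 * R) ^ 2))) *
        volume (Metric.ball (0 : E3) 1)) ^ (1 / 2 : ℝ) ≤
      InitialDataSet.dataWeightedSobolevEDist s δ (Kerr.data M a r₀ hM) (Kerr.data M' a r₀ hM') := by
  have hR0 : 0 < R := lt_of_lt_of_le (by have := Kerr.afRadius_pos a r₀; positivity) hR
  set g := (Kerr.data M a r₀ hM).hFun - (Kerr.data M' a r₀ hM').hFun with hg
  set w : ℝ := min 1 ((1 + 2 * R) ^ (2 * δ)) with hw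
  have hw0 : 0 ≤ w := le_min zero_le_one (Real.rpow_nonneg (by positivity) _)
  have h0 : ENNReal.ofReal (7 * R ^ 3 * (w * ((M - M') ^ 2 / (2 * R) ^ 2))) *
      volume (Metric.ball (0 : E3) 1) ≤
      ∫⁻ x in (Kerr.slice a r₀ : Set E3), ENNReal.ofReal
        ((1 + ‖x‖) ^ (2 * (δ + ((0 : ℕ) : ℝ)) : ℝ) * ‖iteratedFDeriv ℝ 0 g x‖ ^ 2) := by
    refine setLIntegral_ge_shell hR0 (fun y hy ↦ Kerr.mem_slice_of_lt_norm ?_) fun y hy hy2 ↦ ?_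
    · exact lt_of_le_of_lt (by linarith [abs_nonneg a]) hy
    · have hya : 2 * |a| ≤ ‖y‖ := by linarith [(Kerr.afRadius_pos a r₀).le]
      have hyU : y ∈ Kerr.slice a r₀ :=
        Kerr.mem_slice_of_lt_norm (lt_of_le_of_lt (by linarith [abs_nonneg a]) hy)
      have hy0 : 0 < ‖y‖ := hR0.trans hy
      rw [norm_iteratedFDeriv_zero]
      refine ENNReal.ofReal_le_ofReal ?_
      have hwt : w ≤ (1 + ‖y‖) ^ (2 * (δ + ((0 : ℕ) : ℝ)) : ℝ) := by
        have e : (2 * (δ + ((0 : ℕ) : ℝ)) : ℝ) = 2 * δ := by push_cast; ring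
        rw [e]
        rcases le_or_gt 0 (2 * δ) with hδ | hδ
        · exact le_trans (min_le_left _ _) (Real.one_le_rpow (by linarith [norm_nonneg y]) hδ)
        · exact le_trans (min_le_right _ _)
            (Real.rpow_le_rpow_of_nonpos (by linarith [norm_nonneg y]) (by linarith) hδ.le)
      have h2 : |M - M'| / ‖y‖ ≤ ‖g y‖ := by
        rw [hg, Pi.sub_apply]
        exact norm_hFun_sub_hFun_ge_kerr hM hM' hyU hya
      have h3 : |M - M'| / (2 * R) ≤ |M - M'| / ‖y‖ :=
        div_le_div_of_nonneg_left (abs_nonneg _) hy0 hy2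
      have h4 : (M - M') ^ 2 / (2 * R) ^ 2 ≤ ‖g y‖ ^ 2 := by
        rw [show (M - M') ^ 2 / (2 * R) ^ 2 = (|M - M'| / (2 * R)) ^ 2 by rw [div_pow, sq_abs]]
        exact pow_le_pow_left₀ (by positivity) (h3.trans h2) 2
      exact mul_le_mul hwt h4 (by positivity) (le_trans hw0 hwt)
  have hsemi : (ENNReal.ofReal (7 * R ^ 3 * (w * ((M - M') ^ 2 / (2 * R) ^ 2))) *
      volume (Metric.ball (0 : E3) 1)) ^ (1 / 2 : ℝ) ≤
      weightedSobolevSeminorm (Kerr.slice a r₀ : Set E3) s δ g := by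
    unfold weightedSobolevSeminorm
    refine ENNReal.rpow_le_rpow (h0.trans ?_) (by norm_num)
    exact Finset.single_le_sum (f := fun m : ℕ ↦ ∫⁻ x in (Kerr.slice a r₀ : Set E3), ENNReal.ofReal
      ((1 + ‖x‖) ^ (2 * (δ + m) : ℝ) * ‖iteratedFDeriv ℝ m g x‖ ^ 2)) (fun _ _ ↦ zero_le)
      (Finset.mem_range.2 (Nat.succ_pos s))
  unfold InitialDataSet.dataWeightedSobolevEDist
  rw [← hg]
  exact hsemi.trans le_self_add

/-- **Tightness of the ceiling, unconditionally: `γ ≥ 1` with a small constant clears the whole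
visible-edge part of the mass family, uniformly in the spin.** For every `M > 0` (and every
`s, δ`) there is `K' > 0` such that for every sub-extremal spin `a`, every `γ ≥ 1`, every
`0 ≤ c ≤ K'M/2` and every member `Kerr.data M' a M` of mass defect `M − M' ≥ Mχ/2`
(`χ = 1 − (a/M)²`; this includes every exposed-edge and every overspinning member), the member is
NOT in the near-extremal basin `c·χ^γ` around `Kerr.data M a M`. -/
theorem exists_const_basin_clears_visibleEdge [Kerr.Facts] [Kerr.SliceFacts] (s : ℕ) (δ : ℝ)
    {M : ℝ} (hM : 0 < M) :
    ∃ K' : ℝ, 0 < K' ∧ ∀ a : ℝ, Kerr.IsSubextremal M a → ∀ γ : ℝ, 1 ≤ γ →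
      ∀ c : ℝ, 0 ≤ c → c ≤ K' * M / 2 → ∀ (M' : ℝ) (hM' : 0 ≤ M'),
        M * (1 - (a / M) ^ 2) / 2 ≤ M - M' →
          ¬ InitialDataSet.dataWeightedSobolevEDist s δ (Kerr.data M' a M hM') (Kerr.data M a M hM.le) <
              ENNReal.ofReal (c * (1 - (a / M) ^ 2) ^ γ) := by
  set R : ℝ := 4 * M + 2 with hRdef
  have hR0 : 0 < R := by positivity
  set b : ℝ≥0∞ := volume (Metric.ball (0 : E3) 1) with hb
  have hb0 : b ≠ 0 :=
    (Metric.isOpen_ball.measure_pos volume ⟨0, Metric.mem_ball_self one_pos⟩).ne'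
  have hbtop : b ≠ ⊤ := measure_ball_lt_top.ne
  have hbr : 0 < b.toReal := ENNReal.toReal_pos hb0 hbtop
  set w : ℝ := min 1 ((1 + 2 * R) ^ (2 * δ)) with hw
  have hw0 : 0 < w := lt_min one_pos (Real.rpow_pos_of_pos (by positivity) _)
  set Q : ℝ := 7 * R ^ 3 * (w * (1 / (2 * R) ^ 2)) * b.toReal with hQ
  have hQ0 : 0 < Q := by positivity
  refine ⟨√Q, Real.sqrt_pos.2 hQ0, ?_⟩
  intro a ha γ hγ c hc0 hcK M' hM' hdef hlt
  have haM : |a| < M := ha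
  -- R dominates afRadius a M + 2|a|
  have hRa : Kerr.afRadius a M + 2 * |a| ≤ R := by
    unfold Kerr.afRadius
    rw [max_eq_left hM.le]
    have h1 : √(M ^ 2 + a ^ 2) ≤ M + |a| := by
      rw [Real.sqrt_le_left (by positivity)]
      nlinarith [abs_nonneg a, sq_abs a]
    rw [hRdef]
    linarith
  -- χ ∈ (0, 1]
  have hχ0 : 0 < 1 - (a / M) ^ 2 := by
    have h1 : |a / M| < 1 := by rwa [abs_div, abs_of_pos hM, div_lt_one hM]
    have h2 : (a / M) ^ 2 < 1 := (sq_lt_one_iff_abs_lt_one _).2 h1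
    linarith
  have hχ1 : 1 - (a / M) ^ 2 ≤ 1 := by linarith [sq_nonneg (a / M)]
  set χ := 1 - (a / M) ^ 2 with hχ
  -- the radius t of the basin is at most √Q · (M − M')
  set t : ℝ := c * χ ^ γ with ht
  have ht0 : 0 ≤ t := mul_nonneg hc0 (Real.rpow_nonneg hχ0.le _)
  have hΔ0 : 0 ≤ M - M' := le_trans (by positivity) hdef
  have htle : t ≤ √Q * (M - M') := by
    have h1 : χ ^ γ ≤ χ := by
      calc χ ^ γ ≤ χ ^ (1 : ℝ) := Real.rpow_le_rpow_of_exponent_ge hχ0 hχ1 hγ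
        _ = χ := Real.rpow_one χ
    calc t ≤ c * χ := mul_le_mul_of_nonneg_left h1 hc0
      _ ≤ √Q * M / 2 * χ := mul_le_mul_of_nonneg_right hcK hχ0.le
      _ = √Q * (M * χ / 2) := by ring
      _ ≤ √Q * (M - M') := mul_le_mul_of_nonneg_left hdef (Real.sqrt_nonneg _)
  -- the lower bound, in squared form
  have hlow := dataWeightedSobolevEDist_kerr_ge hM' hM.le a M s δ hRa
  rw [← hw] at hlow
  set X : ℝ≥0∞ := ENNReal.ofReal (7 * R ^ 3 * (w * ((M' - M) ^ 2 / (2 * R) ^ 2))) * b with hX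
  have hXt : X ^ (1 / 2 : ℝ) < ENNReal.ofReal t := lt_of_le_of_lt hlow hlt
  have hX2 : X < ENNReal.ofReal t ^ (2 : ℝ) := by
    have := ENNReal.rpow_lt_rpow hXt (by norm_num : (0 : ℝ) < 2)
    rwa [← ENNReal.rpow_mul, show (1 / 2 : ℝ) * 2 = 1 by norm_num, ENNReal.rpow_one] at this
  rw [ENNReal.ofReal_rpow_of_nonneg ht0 (by norm_num), Real.rpow_two] at hX2
  have hXeq : X = ENNReal.ofReal (Q * (M' - M) ^ 2) := by
    rw [hX, ← ENNReal.ofReal_toReal hbtop, ← ENNReal.ofReal_mul (by positivity)]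
    congr 1
    rw [hQ]
    ring
  rw [hXeq, ENNReal.ofReal_lt_ofReal_iff'] at hX2
  obtain ⟨hX2, -⟩ := hX2
  -- but t² ≤ Q (M − M')²
  have : t ^ 2 ≤ Q * (M' - M) ^ 2 := by
    have e : Q * (M' - M) ^ 2 = (√Q * (M - M')) ^ 2 := by
      rw [mul_pow, Real.sq_sqrt hQ0.le]
      ring
    rw [e]
    exact pow_le_pow_left₀ ht0 htle 2
  linarith

end NakedMembers

end Summit.FinalStateConjecture.FinalStateConjecture.Cruxes.CaptureSuffices.Disproof
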